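import Literature.Probability.Percolation.OneArmSeriesRenewal
import Literature.Probability.Percolation.OneArmFromTrace
import HarnessLib

/-!
# Identification of LSW's hitting function with the series solution from Neumann flatness (proofs only)

Topic `Literature/Probability/Percolation`; family `crit-perc`. Def-free, fact-free. The named fact
`Literature.Probability.Percolation.LawlerSchrammWerner2002_hittingPDE` (`OneArmHittingPDE.lean`;
Lawler–Schramm–Werner, *One-arm exponent for critical 2D percolation*, Electron. J. Probab. **7**
(2002), paper no. 2, §2) is, after `LawlerSchrammWerner2002_hittingPDE_of_trace`
(`OneArmHittingPDEAnalytic.lean`), exactly the **trace identification**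
`ν{K | 𝔯(K) ≤ e^{-t}} = u(2π, t)` (`t > 0`, `u = lswHit 6`) for the weak limit `ν` of `lswLaw`. LSW
obtain it from three inputs (pp. 4–7): (i) the renewal identity (2.10)
`h(θ, t) = E[h(Y_T^θ, t - T)]` for the arc hitting function `h(θ, t) = P[𝔯(θ) ≤ e^{-t}]`
(Thm. 2.1 + the radial Loewner equation (2.5)–(2.9)), (ii) the Neumann condition of Lemma 2.3
at `θ = 2π` for the window averages `h̃`, and (iii) uniqueness. This file proves (iii) in the
following strong form, for every `κ > 4` and every antitone `F : ℝ → [0, 1]` with `F = 1` on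
`(-∞, 0]` (the candidate trace; `G := lswHit κ (2π, ·)`, `q = (κ-4)/κ`):

* `le_lswHit_two_pi_of_flat_below` — if for all `L ∈ (0, 1)`, `t > 0` the renewal extension
  `R_L F(θ, t) = renewalST κ (win_L 1_{≤0}) (win_L F) θ t` of the window averages
  `win_L F (s) = ∫₀ᴸ F(s + r) dr` (LSW's `h̃`, window length `L`) satisfies the ONE-SIDED condition
  `liminf_{θ↑2π} (R_L F(θ, t) - win_L F(t)) / (2π - θ)^q ≥ 0`, then `F ≤ G` on `(0, ∞)`;
* `lswHit_two_pi_le_of_flat_above` — if `limsup_{θ↑2π} (…)/(2π - θ)^q ≤ 0` and `F(0+) = 1`, then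
  `G ≤ F` on `(0, ∞)`;
* `eq_lswHit_two_pi_of_flat` — hence `F = G` on `(0, ∞)` under the two-sided condition
  `R_L F(θ, t) - win_L F(t) = o((2π - θ)^q)` and `F(0+) = 1`;
* `lswHit_two_pi_le_of_renewalST_le` — the free side: `G ≤ F` already if `renewalST κ 1_{≤0} F ≤ F`
  on `(0, 2π) × ℝ` (for LSW's `h`: `Q(θ) ⊆ Q(2π)`; this also forces `F(0+) = 1`);
* `eq_lswHit_two_pi_of_renewal` — `F = G` on `(0, ∞)` from domination plus flatness from below.

Note that `o((2π - θ)^q)` (`q = 1/3` for `κ = 6`) is much weaker than the `o(2π - θ)` of LSW's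
(2.12). The proof is a **causal maximum principle in `t`** (not in LSW, who do not need (iii)
since their `h` is the hitting function itself): with `D = F - G` and `Φ = win_L D`,
`R_L F - R_L G = topST κ Φ` inside the strip (linearity; the bottom data cancel), `R_L G` is the
window average of `u` itself (`lswHit_eq_renewalST`, `OneArmSeriesRenewal`) and is flat at `2π` to
order `(2π - θ)²` (`abs_window_lswHit_sub_le`), so `topST κ Φ (θ, t) - Φ(t)` inherits the one-sided
bound; at a running record `t* > 0` of `Φ` (`Φ ≤ Φ(t*) = M` on `(-∞, t*]`, `M > 0`) the renewal
operator only looks into the past (`T ≥ 0`), whence `topST κ Φ (θ, t*) ≤ M P^θ[Y_T = 2π] = M (1 - P^θ[Y_T = 0])`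
and `P^θ[Y_T = 0] ≥ c (2π - θ)^q` (scale function, `measureReal_sleExitsBot_ge`) contradict
flatness from below (`no_pos_record`); running records in the band `[-L, 0]` are controlled by
`|D| ≤ max{λ L, 1 - F(L)}` on `(0, L]`, and `L → 0` concludes.

Consequences for the named fact (`κ = 6`; the identification uses nothing about `ν` but the
shape of `w_ν(t) = ν{K | 𝔯(K) ≤ e^{-t}}`):

* `lswHit_two_pi_eq_measureReal_of_renewalFlat` — for ANY probability measure `ν` on non-empty
  compacts: if `w_ν(0+) = 1` and the renewal extensions of the window averages of `w_ν` are
  `o((2π - θ)^{1/3})`-flat at `2π` for `L ∈ (0, 1)`, `t > 0`, then `u(2π, ·) = w_ν` on `(0, ∞)`;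
* `LawlerSchrammWerner2002_hittingPDE_of_renewalFlat` — hence the named fact from these two
  hypotheses at the weak limit of `lswLaw` (`LawlerSchrammWerner2002_hittingPDE_of_trace`);
* `oneArm_exponent_of_subseqRenewalFlat` — and the named fact, LSW Thm. 1.2
  (`LawlerSchrammWerner2002_scalingLimitExponent`) and Thm. 1.1 (`oneArm_exponent`) from the same
  hypotheses at all subsequential weak limits (`…_of_subseqTrace`, `OneArmFromTrace`);
* `lswHit_two_pi_eq_measureReal_of_renewal`, `oneArm_exponent_of_subseqRenewal` — the same from
  LSW's own hypothesis set: domination `renewalST 6 1_{≤0} w_ν ≤ w_ν` ((2.10) + `Q(θ) ⊆ Q(2π)`) and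
  the from-below estimate of Lemma 2.3 (weakened to `o((2π - θ)^{1/3})`).

For the percolation limits the two hypotheses are (2.10) for the arc hitting function
`h(θ, t) = P[𝔯(θ) ≤ e^{-t}]` (LSW Thm. 2.1 + radial `SLE₆`, resting on
`convergesInLawToSLE_six_triInterface`) together with a weak form of Lemma 2.3 ((2.13)–(2.16); the
half-plane three-arm bound (2.13) and (2.16) are theorems of the tree), and `𝔯(Q(2π)) < 1` a.s.

Also: `renewalST_window` (window averages commute with the renewal extension),
`measureReal_sleExitsBot_ge` (`P^θ[Y_T = 0] ≥ c (2π - θ)^q`). No definitions, no named facts.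

## References

* G. F. Lawler, O. Schramm, W. Werner, *One-arm exponent for critical 2D percolation*, Electron.
  J. Probab. 7 (2002), no. 2, §2: Thm. 2.1, (2.2), (2.10), Lemma 2.2, Lemma 2.3 (2.12), proof of
  Thm. 1.2. [LawlerSchrammWernerEJP2002]

## Mathlib / tree

Tree: `lswHit_eq_renewalST`, `lswHit_two_pi_continuous`, `exp_le_lswHit_two_pi`
(`OneArmSeriesRenewal`, `OneArmSeriesTerms`), `exists_bound_lswSeriesDθ`,
`hasDerivWithinAt_lswSeries_two_pi` (`OneArmSeriesSolution`), `measureReal_sleExitsTop_eq`,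
`sleScale` (`RadialBesselHitting`), `renewalST`, `topST`, `botST` (`RadialBesselRenewal`),
`LawlerSchrammWerner2002_hittingPDE_of_trace` (`OneArmHittingPDEAnalytic`). Mathlib:
`Convex.norm_image_sub_le_of_norm_hasDerivWithin_le`, `integral_integral_swap`,
`IsCompact.exists_isMaxOn`, `integral_rpow`.
-/

noncomputable section

open MeasureTheory Filter Topology Set
open scoped NNReal ENNReal

namespace Literature.Probability.Percolation

open Literature.Probability.RandomPlanarGeometry Literature.Probability.RandomPlanarGeometry.RadialLoewner
open Literature.Probability.Process Literature.Analysis.SpecialFunctions Literature.Analysis.FunctionSpaces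

variable {κ : ℝ≥0} {θ : ℝ}

/-! ### The exit probability through `0` near `θ = 2π` -/

/-- **`P^θ[Y_T = 0] ≥ c (2π - θ)^q`** for `θ ∈ (0, 2π)` (`q = (κ-4)/κ`, `κ > 4`), with
`c = 2^{4/κ} / (q (ψ(2π) - ψ(0)))`: `P^θ[Y_T = 0] = (ψ(2π) - ψ(θ))/(ψ(2π) - ψ(0))` and
`ψ(2π) - ψ(θ) = ∫_θ^{2π} sin(u/2)^{-4/κ} du ≥ ∫_θ^{2π} ((2π - u)/2)^{-4/κ} du = 2^{4/κ} (2π - θ)^q / q`.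
[cite: Lawler2005, §1.11 Lemma 1.25] -/
theorem measureReal_sleExitsBot_ge (hκ : 4 < κ) :
    ∃ c : ℝ, 0 < c ∧ ∀ θ ∈ Ioo 0 (2 * Real.pi),
      c * (2 * Real.pi - θ) ^ lswQ (κ : ℝ) ≤ preWienerMeasure.real (sleExitsBot κ θ) := by
  have hκ' : (4 : ℝ) < κ := by exact_mod_cast hκ
  have hκ0 : (0 : ℝ) < κ := by linarith
  set r : ℝ := -(4 : ℝ) / κ with hr
  have hr1 : -1 < r := by rw [hr, neg_div, neg_lt_neg_iff, div_lt_one hκ0]; exact hκ'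
  have hr0 : r ≤ 0 := by rw [hr, neg_div]; exact neg_nonpos.2 (by positivity)
  have hq : lswQ (κ : ℝ) = r + 1 := by rw [lswQ, hr]; field_simp; ring
  have hqpos : 0 < lswQ (κ : ℝ) := lswQ_pos hκ'
  have hmono := strictMonoOn_sleScale hκ
  set Dn : ℝ := sleScale κ (2 * Real.pi) - sleScale κ 0 with hDn
  have hDn0 : 0 < Dn := sub_pos.2 (hmono ⟨le_rfl, by linarith [Real.pi_pos]⟩
    ⟨by linarith [Real.pi_pos], le_rfl⟩ (by linarith [Real.pi_pos]))
  refine ⟨(2 : ℝ) ^ (-r) / (lswQ (κ : ℝ) * Dn), by positivity, fun θ hθ ↦ ?_⟩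
  set x : ℝ := 2 * Real.pi - θ with hx
  have hx0 : 0 < x := by rw [hx]; linarith [hθ.2]
  -- `P[bot] = (ψ(2π) - ψ(θ)) / Dn`
  have htop := measureReal_sleExitsTop_eq hκ hθ
  have hsum := measureReal_sleExitsTop_add_sleExitsBot hκ hθ
  have hbot : preWienerMeasure.real (sleExitsBot κ θ) = (sleScale κ (2 * Real.pi) - sleScale κ θ) / Dn := by
    rw [eq_div_iff hDn0.ne']
    have : preWienerMeasure.real (sleExitsTop κ θ) * Dn = sleScale κ θ - sleScale κ 0 := by
      rw [htop, div_mul_cancel₀ _ hDn0.ne']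
    nlinarith [this, hsum]
  -- `ψ(2π) - ψ(θ) = ∫_θ^{2π} density ≥ 2^{-r} x^{r+1}/(r+1)`
  have hint : sleScale κ (2 * Real.pi) - sleScale κ θ = ∫ u in θ..2 * Real.pi, sleScaleDensity κ u := by
    rw [sleScale, sleScale, intervalIntegral.integral_interval_sub_left]
    · exact intervalIntegrable_sleScaleDensity hκ _ _ ⟨by linarith [Real.pi_pos], by linarith [Real.pi_pos]⟩
        ⟨by linarith [Real.pi_pos], le_rfl⟩
    · exact intervalIntegrable_sleScaleDensity hκ _ _ ⟨by linarith [Real.pi_pos], by linarith [Real.pi_pos]⟩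
        ⟨hθ.1.le, hθ.2.le⟩
  have hlow : ∫ u in θ..2 * Real.pi, ((2 * Real.pi - u) / 2) ^ r = (2 : ℝ) ^ (-r) * x ^ (r + 1) / (r + 1) := by
    have h1 : (∫ u in θ..2 * Real.pi, ((2 * Real.pi - u) / 2) ^ r) = ∫ v in (0 : ℝ)..x, (v / 2) ^ r := by
      rw [intervalIntegral.integral_comp_sub_left (fun v ↦ (v / 2) ^ r) (2 * Real.pi), sub_self, hx]
    have h2 : (∫ v in (0 : ℝ)..x, (v / 2) ^ r) = ∫ v in (0 : ℝ)..x, (2 : ℝ) ^ (-r) * v ^ r := by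
      refine intervalIntegral.integral_congr fun v hv ↦ ?_
      rw [uIcc_of_le hx0.le] at hv
      rw [Real.div_rpow hv.1 zero_le_two, Real.rpow_neg zero_le_two, div_eq_mul_inv, mul_comm]
    rw [h1, h2, intervalIntegral.integral_const_mul, integral_rpow (Or.inl hr1), Real.zero_rpow (by linarith),
      sub_zero, mul_div_assoc]
  have hcmp : ∫ u in θ..2 * Real.pi, ((2 * Real.pi - u) / 2) ^ r ≤ ∫ u in θ..2 * Real.pi, sleScaleDensity κ u := by
    refine intervalIntegral.integral_mono_on_of_le_Ioo hθ.2.le ?_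
      (intervalIntegrable_sleScaleDensity hκ _ _ ⟨hθ.1.le, hθ.2.le⟩ ⟨by linarith [Real.pi_pos], le_rfl⟩)
      fun u hu ↦ ?_
    · have h := (intervalIntegral.intervalIntegrable_rpow' hr1 (a := 0) (b := x)).comp_sub_left (2 * Real.pi)
      simp only [sub_zero] at h
      rw [show 2 * Real.pi - x = θ by rw [hx]; ring] at h
      -- `h : IntervalIntegrable (fun u ↦ (2π - u)^r) volume (2π) θ`; rescale by `2^{-r}`
      have h' : IntervalIntegrable (fun u ↦ (2 : ℝ) ^ (-r) * (2 * Real.pi - u) ^ r) volume θ (2 * Real.pi) :=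
        h.symm.const_mul ((2 : ℝ) ^ (-r))
      refine h'.congr fun u hu ↦ ?_
      rw [uIoc_of_le hθ.2.le] at hu
      show (2 : ℝ) ^ (-r) * (2 * Real.pi - u) ^ r = ((2 * Real.pi - u) / 2) ^ r
      rw [Real.div_rpow (by linarith [hu.2]) zero_le_two, Real.rpow_neg zero_le_two, div_eq_mul_inv, mul_comm]
    · have hu2 : 0 < (2 * Real.pi - u) / 2 := by linarith [hu.2]
      have hsin : Real.sin (u / 2) ≤ (2 * Real.pi - u) / 2 := by
        have : Real.sin (u / 2) = Real.sin ((2 * Real.pi - u) / 2) := by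
          rw [show (2 * Real.pi - u) / 2 = Real.pi - u / 2 by ring, Real.sin_pi_sub]
        rw [this]; exact Real.sin_le hu2.le
      have hsinpos : 0 < Real.sin (u / 2) := sin_half_pos ⟨hθ.1.trans hu.1, hu.2⟩
      rw [sleScaleDensity, ← hr]
      exact Real.rpow_le_rpow_of_nonpos hsinpos hsin hr0
  -- assemble
  rw [hbot, hint, hq, le_div_iff₀ hDn0]
  calc (2 : ℝ) ^ (-r) / ((r + 1) * Dn) * x ^ (r + 1) * Dn = (2 : ℝ) ^ (-r) * x ^ (r + 1) / (r + 1) := by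
        field_simp
    _ = ∫ u in θ..2 * Real.pi, ((2 * Real.pi - u) / 2) ^ r := hlow.symm
    _ ≤ _ := hcmp

/-! ### Window averages commute with the renewal extension -/

section Window

variable (κ)

/-- **Fubini for one exit side**: for a measurable set `S` of paths, bounded measurable `W` and
`L ≥ 0`, `E[1_S ∫₀ᴸ W(t - T + r) dr] = ∫₀ᴸ E[1_S W(t + r - T)] dr`, and the latter integrand is
interval integrable in `r`. [folklore] -/
theorem integral_indicator_window {S : Set (ℝ≥0 → ℝ)} (hS : MeasurableSet S) {W : ℝ → ℝ}
    (hWm : Measurable W) {C : ℝ} (hWb : ∀ s, |W s| ≤ C) (θ t : ℝ) {L : ℝ} (hL : 0 ≤ L) :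
    (∫ ω, S.indicator (fun ω ↦ ∫ r in (0 : ℝ)..L, W (t - sleLifetimeReal κ θ ω + r)) ω ∂preWienerMeasure =
      ∫ r in (0 : ℝ)..L, ∫ ω, S.indicator (fun ω ↦ W (t + r - sleLifetimeReal κ θ ω)) ω ∂preWienerMeasure) ∧
    IntervalIntegrable (fun r ↦ ∫ ω, S.indicator (fun ω ↦ W (t + r - sleLifetimeReal κ θ ω)) ω ∂preWienerMeasure)
      volume 0 L := by
  haveI := isProbabilityMeasure_preWienerMeasure'
  have hC : 0 ≤ C := (abs_nonneg _).trans (hWb 0)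
  set ν : Measure ℝ := volume.restrict (Ioc 0 L) with hν
  haveI : IsFiniteMeasure ν := by rw [hν]; infer_instance
  -- the joint integrand
  set f : (ℝ≥0 → ℝ) × ℝ → ℝ := fun p ↦
    S.indicator (fun ω ↦ W (t + p.2 - sleLifetimeReal κ θ ω)) p.1 with hf
  have hfm : Measurable f := by
    have h1 : Measurable fun p : (ℝ≥0 → ℝ) × ℝ ↦ W (t + p.2 - sleLifetimeReal κ θ p.1) :=
      hWm.comp ((measurable_const.add measurable_snd).sub ((measurable_sleLifetimeReal κ θ).comp measurable_fst))
    have h2 : f = (S ×ˢ (univ : Set ℝ)).indicator fun p : (ℝ≥0 → ℝ) × ℝ ↦ W (t + p.2 - sleLifetimeReal κ θ p.1) := by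
      funext p
      simp only [hf]
      by_cases hp : p.1 ∈ S
      · rw [indicator_of_mem hp, indicator_of_mem (show p ∈ S ×ˢ univ from ⟨hp, mem_univ _⟩)]
      · rw [indicator_of_notMem hp, indicator_of_notMem (fun h ↦ hp h.1)]
    rw [h2]
    exact h1.indicator (hS.prod MeasurableSet.univ)
  have hfb : ∀ p, ‖f p‖ ≤ C := fun p ↦ by
    rw [Real.norm_eq_abs]
    simp only [hf]
    by_cases hp : p.1 ∈ S
    · rw [indicator_of_mem hp]; exact hWb _
    · rw [indicator_of_notMem hp, abs_zero]; exact hC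
  have hfi : Integrable f (preWienerMeasure.prod ν) :=
    (integrable_const C).mono' hfm.aestronglyMeasurable (Eventually.of_forall hfb)
  -- left-hand side as an iterated integral
  have hlhs : (∫ ω, S.indicator (fun ω ↦ ∫ r in (0 : ℝ)..L, W (t - sleLifetimeReal κ θ ω + r)) ω ∂preWienerMeasure)
      = ∫ ω, ∫ r, f (ω, r) ∂ν ∂preWienerMeasure := by
    refine integral_congr_ae (Eventually.of_forall fun ω ↦ ?_)
    simp only [hf, hν]
    rw [← intervalIntegral.integral_of_le hL]
    by_cases hω : ω ∈ S
    · simp only [indicator_of_mem hω]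
      refine intervalIntegral.integral_congr fun r _ ↦ ?_
      ring_nf
    · simp only [indicator_of_notMem hω, intervalIntegral.integral_zero]
  have hrhs : (∫ r in (0 : ℝ)..L, ∫ ω, S.indicator (fun ω ↦ W (t + r - sleLifetimeReal κ θ ω)) ω ∂preWienerMeasure)
      = ∫ r, ∫ ω, f (ω, r) ∂preWienerMeasure ∂ν := by
    rw [intervalIntegral.integral_of_le hL]
  refine ⟨by rw [hlhs, hrhs, integral_integral_swap hfi], ?_⟩
  rw [intervalIntegrable_iff_integrableOn_Ioc_of_le hL]
  exact hfi.integral_prod_right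

/-- **`topST` of a window average is the window average of `topST`** (bounded measurable `U`,
`L ≥ 0`), with interval integrability of `r ↦ topST κ U θ (t + r)`. [folklore] -/
theorem topST_window {U : ℝ → ℝ} (hUm : Measurable U) {C : ℝ} (hUb : ∀ s, |U s| ≤ C) (θ t : ℝ)
    {L : ℝ} (hL : 0 ≤ L) :
    topST κ (fun s ↦ ∫ r in (0 : ℝ)..L, U (s + r)) θ t = ∫ r in (0 : ℝ)..L, topST κ U θ (t + r) ∧
      IntervalIntegrable (fun r ↦ topST κ U θ (t + r)) volume 0 L :=
  integral_indicator_window κ (measurableSet_sleExitsTop κ θ) hUm hUb θ t hL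

/-- **`botST` of a window average is the window average of `botST`.** [folklore] -/
theorem botST_window {V : ℝ → ℝ} (hVm : Measurable V) {C : ℝ} (hVb : ∀ s, |V s| ≤ C) (θ t : ℝ)
    {L : ℝ} (hL : 0 ≤ L) :
    botST κ (fun s ↦ ∫ r in (0 : ℝ)..L, V (s + r)) θ t = ∫ r in (0 : ℝ)..L, botST κ V θ (t + r) ∧
      IntervalIntegrable (fun r ↦ botST κ V θ (t + r)) volume 0 L :=
  integral_indicator_window κ (measurableSet_sleExitsBot κ θ) hVm hVb θ t hL

/-- **Window averages commute with the renewal extension** on all of `ℝ × ℝ` (the boundary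
branches of `renewalST` are the data themselves). [cite: LawlerSchrammWernerEJP2002, §2 (2.10), (2.12)] -/
theorem renewalST_window {V U : ℝ → ℝ} (hVm : Measurable V) (hUm : Measurable U) {C : ℝ}
    (hVb : ∀ s, |V s| ≤ C) (hUb : ∀ s, |U s| ≤ C) (θ t : ℝ) {L : ℝ} (hL : 0 ≤ L) :
    renewalST κ (fun s ↦ ∫ r in (0 : ℝ)..L, V (s + r)) (fun s ↦ ∫ r in (0 : ℝ)..L, U (s + r)) θ t =
      ∫ r in (0 : ℝ)..L, renewalST κ V U θ (t + r) := by
  by_cases h0 : θ ≤ 0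
  · simp only [renewalST, if_pos h0]
  · by_cases h2 : 2 * Real.pi ≤ θ
    · simp only [renewalST, if_neg h0, if_pos h2]
    · have hθ : θ ∈ Ioo 0 (2 * Real.pi) := ⟨not_le.1 h0, not_le.1 h2⟩
      simp only [renewalST_of_mem κ _ _ hθ]
      obtain ⟨hb, hbi⟩ := botST_window κ hVm hVb θ t hL
      obtain ⟨ht', hti⟩ := topST_window κ hUm hUb θ t hL
      rw [hb, ht', ← intervalIntegral.integral_add hbi hti]

end Window

/-! ### Bounded measurable time profiles: integrability and linearity of `topST` -/

/-- The top-exit integrand of `topST κ f θ t` is integrable for bounded measurable `f`. [folklore] -/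
theorem integrable_indicator_top {f : ℝ → ℝ} (hfm : Measurable f) {C : ℝ} (hfb : ∀ s, |f s| ≤ C) (θ t : ℝ) :
    Integrable (fun ω ↦ (sleExitsTop κ θ).indicator (fun ω ↦ f (t - sleLifetimeReal κ θ ω)) ω) preWienerMeasure := by
  haveI := isProbabilityMeasure_preWienerMeasure'
  have hC : 0 ≤ C := (abs_nonneg _).trans (hfb 0)
  refine integrable_of_abs_le ((hfm.comp (measurable_const.sub (measurable_sleLifetimeReal κ θ))).indicator
    (measurableSet_sleExitsTop κ θ)) (C := C) fun ω ↦ ?_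
  by_cases hω : ω ∈ sleExitsTop κ θ
  · rw [indicator_of_mem hω]; exact hfb _
  · rw [indicator_of_notMem hω, abs_zero]; exact hC

/-- **Linearity**: `topST κ f - topST κ g = topST κ (f - g)` for bounded measurable profiles. [folklore] -/
theorem topST_sub {f g : ℝ → ℝ} (hfm : Measurable f) (hgm : Measurable g) {C : ℝ} (hfb : ∀ s, |f s| ≤ C)
    (hgb : ∀ s, |g s| ≤ C) (θ t : ℝ) :
    topST κ f θ t - topST κ g θ t = topST κ (fun s ↦ f s - g s) θ t := by
  unfold topST topExpect
  rw [← integral_sub (integrable_indicator_top hfm hfb θ t) (integrable_indicator_top hgm hgb θ t)]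
  refine integral_congr_ae (Eventually.of_forall fun ω ↦ ?_)
  by_cases hω : ω ∈ sleExitsTop κ θ
  · simp only [indicator_of_mem hω]
  · simp only [indicator_of_notMem hω, sub_zero]

/-- `topST κ (-f) = -topST κ f`. [folklore] -/
theorem topST_neg (f : ℝ → ℝ) (θ t : ℝ) : topST κ (fun s ↦ -f s) θ t = -topST κ f θ t := by
  unfold topST
  exact topExpect_neg κ (fun x ↦ f (t - x)) θ

/-- **The renewal operator looks into the past**: if `Φ ≤ M` on `(-∞, t]` (bounded measurable `Φ`)
then `topST κ Φ θ t ≤ M · P^θ[Y_T = 2π]` (`T ≥ 0`). [folklore] -/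
theorem topST_le_mul_measureReal {Φ : ℝ → ℝ} (hΦm : Measurable Φ) {B : ℝ} (hΦb : ∀ s, |Φ s| ≤ B)
    {t M : ℝ} (hrec : ∀ s, s ≤ t → Φ s ≤ M) (θ : ℝ) :
    topST κ Φ θ t ≤ M * preWienerMeasure.real (sleExitsTop κ θ) := by
  haveI := isProbabilityMeasure_preWienerMeasure'
  unfold topST topExpect
  have h2 : ∫ ω, (sleExitsTop κ θ).indicator (fun _ ↦ M) ω ∂preWienerMeasure =
      M * preWienerMeasure.real (sleExitsTop κ θ) := by
    rw [integral_indicator_const _ (measurableSet_sleExitsTop κ θ), smul_eq_mul, mul_comm]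
  rw [← h2]
  refine integral_mono (integrable_indicator_top hΦm hΦb θ t)
    ((integrable_const M).indicator (measurableSet_sleExitsTop κ θ)) fun ω ↦ ?_
  by_cases hω : ω ∈ sleExitsTop κ θ
  · simp only [indicator_of_mem hω]
    exact hrec _ (by linarith [sleLifetimeReal_nonneg κ θ ω])
  · simp only [indicator_of_notMem hω, le_refl]

/-! ### The causal maximum principle: no running records at flat times -/

/-- **No positive running record**: if a bounded measurable `Φ` has `Φ ≤ Φ(t) = M` on `(-∞, t]`
with `M > 0`, then `topST κ Φ (θ, t) - Φ(t) ≤ -M P^θ[Y_T = 0] ≤ -M c (2π - θ)^q`, which is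
incompatible with flatness from below `topST κ Φ (θ, t) - Φ(t) ≥ -ε (2π - θ)^q` eventually as
`θ ↑ 2π`, for every `ε > 0` (`κ > 4`). [folklore] -/
theorem no_pos_record (hκ : 4 < κ) {Φ : ℝ → ℝ} (hΦm : Measurable Φ) {B : ℝ} (hΦb : ∀ s, |Φ s| ≤ B)
    {t : ℝ} (hrec : ∀ s, s ≤ t → Φ s ≤ Φ t) (hpos : 0 < Φ t)
    (hflat : ∀ ε : ℝ, 0 < ε → ∀ᶠ θ in 𝓝[<] (2 * Real.pi),
      -(ε * (2 * Real.pi - θ) ^ lswQ (κ : ℝ)) ≤ topST κ Φ θ t - Φ t) : False := by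
  haveI := isProbabilityMeasure_preWienerMeasure'
  obtain ⟨c, hc, hbot⟩ := measureReal_sleExitsBot_ge hκ
  set M := Φ t with hM
  have hε : 0 < M * c / 2 := by positivity
  have hev := (hflat (M * c / 2) hε).and (Ioo_mem_nhdsLT (by positivity : (0 : ℝ) < 2 * Real.pi))
  obtain ⟨θ, h1, hθ⟩ := hev.exists
  have hx : 0 < (2 * Real.pi - θ) ^ lswQ (κ : ℝ) := Real.rpow_pos_of_pos (by linarith [hθ.2]) _
  have htop := topST_le_mul_measureReal (κ := κ) hΦm hΦb hrec θ
  have hsum := measureReal_sleExitsTop_add_sleExitsBot hκ hθ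
  have hb := hbot θ hθ
  -- `topST ≤ M (1 - P[bot]) ≤ M - M c x^q`
  have h3 : topST κ Φ θ t - M ≤ -(M * c * (2 * Real.pi - θ) ^ lswQ (κ : ℝ)) := by
    have : M * preWienerMeasure.real (sleExitsTop κ θ) = M - M * preWienerMeasure.real (sleExitsBot κ θ) := by
      have h := congrArg (fun r ↦ M * r) hsum
      simp only [mul_add, mul_one] at h
      linarith
    nlinarith [mul_le_mul_of_nonneg_left hb hpos.le]
  nlinarith

/-- **No negative running record** (flatness from above; apply `no_pos_record` to `-Φ`). [folklore] -/
theorem no_neg_record (hκ : 4 < κ) {Φ : ℝ → ℝ} (hΦm : Measurable Φ) {B : ℝ} (hΦb : ∀ s, |Φ s| ≤ B)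
    {t : ℝ} (hrec : ∀ s, s ≤ t → Φ t ≤ Φ s) (hneg : Φ t < 0)
    (hflat : ∀ ε : ℝ, 0 < ε → ∀ᶠ θ in 𝓝[<] (2 * Real.pi),
      topST κ Φ θ t - Φ t ≤ ε * (2 * Real.pi - θ) ^ lswQ (κ : ℝ)) : False := by
  refine no_pos_record hκ (Φ := fun s ↦ -Φ s) hΦm.neg (B := B) (fun s ↦ by rw [abs_neg]; exact hΦb s)
    (t := t) (fun s hs ↦ neg_le_neg (hrec s hs)) (by linarith) fun ε hε ↦ ?_
  filter_upwards [hflat ε hε] with θ hθ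
  rw [topST_neg]
  linarith

/-! ### The window averages of `u` are flat at `2π` to second order -/

/-- **`|u(2π, s) - u(θ, s)| ≤ C (2π - θ)²`** for `θ ∈ (π, 2π)`, `s ≥ t₀ > 0` (`C = C(κ, t₀)`): the mean
value theorem on `[θ, 2π]` with `|∂_θ u(ξ, s)| ≤ M cos(ξ/4) ≤ M (2π - θ)/4`
(`exists_bound_lswSeriesDθ`) and the reflecting condition at `2π`. [cite: LawlerSchrammWernerEJP2002, Lemma 2.3 (2.12)] -/
theorem abs_lswHit_two_pi_sub_le {κ : ℝ} (hκ : 4 < κ) {t₀ : ℝ} (ht₀ : 0 < t₀) :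
    ∃ C : ℝ, 0 ≤ C ∧ ∀ θ ∈ Ioo Real.pi (2 * Real.pi), ∀ s, t₀ ≤ s →
      |lswHit κ (2 * Real.pi) s - lswHit κ θ s| ≤ C * (2 * Real.pi - θ) ^ 2 := by
  obtain ⟨M, hM0, hM⟩ := exists_bound_lswSeriesDθ hκ (lswInitCoeff_hyp hκ) ht₀
  refine ⟨M / 4, by positivity, fun θ hθ s hs ↦ ?_⟩
  have hs0 : 0 < s := ht₀.trans_le hs
  have hθ' : θ ∈ Icc 0 (2 * Real.pi) := ⟨by linarith [hθ.1, Real.pi_pos], hθ.2.le⟩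
  rw [lswHit_eq_lswSeries hs0 ⟨by positivity, le_rfl⟩, lswHit_eq_lswSeries hs0 hθ']
  set f : ℝ → ℝ := fun x ↦ lswSeries κ (lswInitCoeff κ) x s with hf
  set f' : ℝ → ℝ := fun x ↦ if x < 2 * Real.pi then lswSeriesDθ κ (lswInitCoeff κ) x s else 0 with hf'
  have hderiv : ∀ x ∈ Icc θ (2 * Real.pi), HasDerivWithinAt f (f' x) (Icc θ (2 * Real.pi)) x := by
    intro x hx
    rcases hx.2.lt_or_eq with hlt | heq
    · have hx' : x ∈ Ioo 0 (2 * Real.pi) := ⟨by linarith [hx.1, hθ.1, Real.pi_pos], hlt⟩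
      simp only [hf', if_pos hlt]
      exact (hasDerivAt_lswSeries_θ hκ (lswInitCoeff_hyp hκ) hx' hs0).hasDerivWithinAt
    · subst heq
      simp only [hf', if_neg (lt_irrefl _)]
      exact (hasDerivWithinAt_lswSeries_two_pi hκ (lswInitCoeff_hyp hκ) hs0).mono Icc_subset_Iic_self
  have hcosθ : Real.cos (θ / 4) ≤ (2 * Real.pi - θ) / 4 := by
    rw [← Real.sin_pi_div_two_sub, show Real.pi / 2 - θ / 4 = (2 * Real.pi - θ) / 4 by ring]
    exact Real.sin_le (by linarith [hθ.2])
  have hbound : ∀ x ∈ Icc θ (2 * Real.pi), ‖f' x‖ ≤ M * ((2 * Real.pi - θ) / 4) := by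
    intro x hx
    rw [Real.norm_eq_abs]
    rcases hx.2.lt_or_eq with hlt | heq
    · simp only [hf', if_pos hlt]
      have h1 := hM x ⟨lt_of_lt_of_le hθ.1 hx.1, hlt⟩ s hs
      have hcos : Real.cos (x / 4) ≤ Real.cos (θ / 4) :=
        Real.cos_le_cos_of_nonneg_of_le_pi (by linarith [hθ.1, Real.pi_pos]) (by linarith [hx.2, Real.pi_pos])
          (by linarith [hx.1])
      calc |lswSeriesDθ κ (lswInitCoeff κ) x s| ≤ M * Real.cos (x / 4) := h1
        _ ≤ M * ((2 * Real.pi - θ) / 4) := mul_le_mul_of_nonneg_left (hcos.trans hcosθ) hM0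
    · subst heq
      simp only [hf', if_neg (lt_irrefl _), abs_zero]
      exact mul_nonneg hM0 (by linarith [hθ.2])
  have hmvt := Convex.norm_image_sub_le_of_norm_hasDerivWithin_le hderiv hbound (convex_Icc _ _)
    (left_mem_Icc.2 hθ.2.le) (right_mem_Icc.2 hθ.2.le)
  rw [Real.norm_eq_abs, Real.norm_eq_abs, abs_of_nonneg (by linarith [hθ.2] : (0 : ℝ) ≤ 2 * Real.pi - θ)] at hmvt
  calc |f (2 * Real.pi) - f θ| ≤ M * ((2 * Real.pi - θ) / 4) * (2 * Real.pi - θ) := hmvt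
    _ = M / 4 * (2 * Real.pi - θ) ^ 2 := by ring

/-- **The window average of `u` is flat at `2π` to second order**: for `t > 0` there is `C` with
`|∫₀ᴸ (u(θ, t + r) - u(2π, t + r)) dr| ≤ C L (2π - θ)²` for `θ ∈ (π, 2π)`, `L ≥ 0`.
[cite: LawlerSchrammWernerEJP2002, Lemma 2.3 (2.12)] -/
theorem abs_window_lswHit_sub_le {κ : ℝ} (hκ : 4 < κ) {t : ℝ} (ht : 0 < t) :
    ∃ C : ℝ, 0 ≤ C ∧ ∀ θ ∈ Ioo Real.pi (2 * Real.pi), ∀ L : ℝ, 0 ≤ L →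
      |∫ r in (0 : ℝ)..L, (lswHit κ θ (t + r) - lswHit κ (2 * Real.pi) (t + r))| ≤ C * L * (2 * Real.pi - θ) ^ 2 := by
  obtain ⟨C, hC0, hC⟩ := abs_lswHit_two_pi_sub_le hκ ht
  refine ⟨C, hC0, fun θ hθ L hL ↦ ?_⟩
  have h := intervalIntegral.norm_integral_le_of_norm_le_const (a := 0) (b := L) (C := C * (2 * Real.pi - θ) ^ 2)
    (f := fun r ↦ lswHit κ θ (t + r) - lswHit κ (2 * Real.pi) (t + r)) fun r hr ↦ by
      rw [uIoc_of_le hL] at hr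
      rw [Real.norm_eq_abs, abs_sub_comm]
      exact hC θ hθ (t + r) (by linarith [hr.1])
  rw [Real.norm_eq_abs, sub_zero, abs_of_nonneg hL] at h
  calc _ ≤ C * (2 * Real.pi - θ) ^ 2 * L := h
    _ = C * L * (2 * Real.pi - θ) ^ 2 := by ring

/-! ### The identification theorems -/

section Identification

variable (hκ : 4 < κ) {F : ℝ → ℝ} (hFa : Antitone F) (hF1 : ∀ s, s ≤ 0 → F s = 1) (hF0 : ∀ s, 0 ≤ F s)
include hκ hFa hF1 hF0

omit hκ hF0 in
/-- `F ≤ 1`. [folklore] -/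
theorem trace_le_one (s : ℝ) : F s ≤ 1 := by
  rcases le_or_gt s 0 with hs | hs
  · exact (hF1 s hs).le
  · exact (hFa hs.le).trans (hF1 0 le_rfl).le

/-- The data are bounded and measurable: `|F| ≤ 1`, `|1_{≤0}| ≤ 1`, `|G| ≤ 1`, `|F - G| ≤ 1`. [folklore] -/
theorem abs_trace_sub_lswHit_le_one (s : ℝ) : |F s - lswHit κ (2 * Real.pi) s| ≤ 1 := by
  have hκ' : (4 : ℝ) < κ := by exact_mod_cast hκ
  have h1 := trace_le_one hFa hF1 s
  have h2 := hF0 s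
  have h3 := lswHit_mem_Icc' hκ' (2 * Real.pi) s
  rw [abs_le]; constructor <;> linarith [h3.1, h3.2]

/-- **The difference of the renewal extensions of the window averages of `F` and of `G = u(2π, ·)`
is `topST` of the window average of `D = F - G`** (inside the strip; the bottom data cancel).
[folklore] -/
theorem renewalST_window_sub (hθ : θ ∈ Ioo 0 (2 * Real.pi)) (t : ℝ) {L : ℝ} (hL : 0 ≤ L) :
    renewalST κ (fun s ↦ ∫ r in (0 : ℝ)..L, bottomDatum (s + r)) (fun s ↦ ∫ r in (0 : ℝ)..L, F (s + r)) θ t -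
      renewalST κ (fun s ↦ ∫ r in (0 : ℝ)..L, bottomDatum (s + r))
        (fun s ↦ ∫ r in (0 : ℝ)..L, lswHit κ (2 * Real.pi) (s + r)) θ t =
      topST κ (fun s ↦ ∫ r in (0 : ℝ)..L, (F (s + r) - lswHit κ (2 * Real.pi) (s + r))) θ t := by
  have hκ' : (4 : ℝ) < κ := by exact_mod_cast hκ
  have hFm : Measurable F := hFa.measurable
  have hGm : Measurable fun s ↦ lswHit κ (2 * Real.pi) s := (lswHit_two_pi_continuous hκ').measurable
  have hFb : ∀ s, |F s| ≤ 1 := fun s ↦ by rw [abs_of_nonneg (hF0 s)]; exact trace_le_one hFa hF1 s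
  have hGb : ∀ s, |lswHit κ (2 * Real.pi) s| ≤ 1 := fun s ↦ abs_lswHit_le_one hκ' _ _
  -- window averages are bounded measurable
  have hwm : ∀ {g : ℝ → ℝ}, Measurable g → Measurable fun s ↦ ∫ r in (0 : ℝ)..L, g (s + r) := by
    intro g hg
    have h2 : Measurable (Function.uncurry fun (s r : ℝ) ↦ g (s + r)) := hg.comp (measurable_fst.add measurable_snd)
    simp_rw [intervalIntegral.integral_of_le hL]
    exact (h2.stronglyMeasurable.integral_prod_right' (ν := volume.restrict (Ioc 0 L))).measurable
  have hwb : ∀ {g : ℝ → ℝ}, (∀ s, |g s| ≤ 1) → ∀ s, |∫ r in (0 : ℝ)..L, g (s + r)| ≤ 1 * |L - 0| := by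
    intro g hg s
    have := intervalIntegral.norm_integral_le_of_norm_le_const (a := 0) (b := L) (C := 1)
      (f := fun r ↦ g (s + r)) fun r _ ↦ by rw [Real.norm_eq_abs]; exact hg _
    rwa [Real.norm_eq_abs] at this
  rw [renewalST_of_mem κ _ _ hθ, renewalST_of_mem κ _ _ hθ, add_sub_add_left_eq_sub,
    topST_sub (hwm hFm) (hwm hGm) (hwb hFb) (hwb hGb)]
  congr 1
  funext s
  have h1 : IntervalIntegrable (fun r ↦ F (s + r)) volume 0 L :=
    intervalIntegrable_of_bdd (hFm.comp (measurable_const.add measurable_id)) (fun r ↦ hFb _) 0 L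
  have h2 : IntervalIntegrable (fun r ↦ lswHit κ (2 * Real.pi) (s + r)) volume 0 L :=
    intervalIntegrable_of_bdd (hGm.comp (measurable_const.add measurable_id)) (fun r ↦ hGb _) 0 L
  rw [← intervalIntegral.integral_sub h1 h2]

omit hFa hF1 hF0 in
/-- **The renewal extension of the window averages of `G = u(2π, ·)` is the window average of `u`**
(`θ ∈ [0, 2π]`): `renewalST_window` and `lswHit_eq_renewalST`. [cite: LawlerSchrammWernerEJP2002, §2 (2.10)] -/
theorem renewalST_window_lswHit (hθ : θ ∈ Icc 0 (2 * Real.pi)) (t : ℝ) {L : ℝ} (hL : 0 ≤ L) :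
    renewalST κ (fun s ↦ ∫ r in (0 : ℝ)..L, bottomDatum (s + r))
        (fun s ↦ ∫ r in (0 : ℝ)..L, lswHit κ (2 * Real.pi) (s + r)) θ t =
      ∫ r in (0 : ℝ)..L, lswHit κ θ (t + r) := by
  have hκ' : (4 : ℝ) < κ := by exact_mod_cast hκ
  have hGm : Measurable fun s ↦ lswHit κ (2 * Real.pi) s := (lswHit_two_pi_continuous hκ').measurable
  have hGb : ∀ s, |lswHit κ (2 * Real.pi) s| ≤ 1 := fun s ↦ abs_lswHit_le_one hκ' _ _
  have hbb : ∀ s, |bottomDatum s| ≤ 1 := fun s ↦ by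
    have := bottomDatum_mem_Icc s; rw [abs_of_nonneg this.1]; exact this.2
  rw [renewalST_window κ measurable_bottomDatum hGm hbb hGb θ t hL]
  refine intervalIntegral.integral_congr fun r _ ↦ ?_
  exact (lswHit_eq_renewalST hκ hθ (t + r)).symm

/-- The window average `Φ_L(s) = ∫₀ᴸ D(s + r) dr` of `D = F - G`: continuity, vanishing for
`s ≤ -L`, and the band bounds `-(1 - F(L)) L ≤ Φ_L(s) ≤ λ L · L` for `s ∈ [-L, 0]`
(`D = 0` on `(-∞, 0]`, `F(L) - 1 ≤ D ≤ 1 - e^{-λ r} ≤ λ r` on `(0, L]`). [folklore] -/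
theorem window_sub_props {L : ℝ} (hL : 0 ≤ L) :
    (Continuous fun s ↦ ∫ r in (0 : ℝ)..L, (F (s + r) - lswHit κ (2 * Real.pi) (s + r))) ∧
    (∀ s, s ≤ -L → (∫ r in (0 : ℝ)..L, (F (s + r) - lswHit κ (2 * Real.pi) (s + r))) = 0) ∧
    (∀ s ∈ Icc (-L) 0, (∫ r in (0 : ℝ)..L, (F (s + r) - lswHit κ (2 * Real.pi) (s + r))) ≤
      lswLambda (κ : ℝ) * L * L) ∧
    (∀ s ∈ Icc (-L) 0, -((1 - F L) * L) ≤ ∫ r in (0 : ℝ)..L, (F (s + r) - lswHit κ (2 * Real.pi) (s + r))) := by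
  have hκ' : (4 : ℝ) < κ := by exact_mod_cast hκ
  have hlam : 0 < lswLambda (κ : ℝ) := lswLambda_pos hκ'
  set D : ℝ → ℝ := fun s ↦ F s - lswHit κ (2 * Real.pi) s with hD
  have hDm : Measurable D := hFa.measurable.sub (lswHit_two_pi_continuous hκ').measurable
  have hDb : ∀ s, |D s| ≤ 1 := abs_trace_sub_lswHit_le_one hκ hFa hF1 hF0
  have hDi : ∀ a b, IntervalIntegrable D volume a b := intervalIntegrable_of_bdd hDm hDb
  have hD0 : ∀ s, s ≤ 0 → D s = 0 := fun s hs ↦ by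
    simp only [hD, hF1 s hs, lswHit, if_pos hs, sub_self]
  have hDup : ∀ s, 0 < s → D s ≤ lswLambda (κ : ℝ) * s := fun s hs ↦ by
    have h1 := (exp_le_lswHit_two_pi hκ' hs).1
    have h2 := trace_le_one hFa hF1 s
    have h3 := Real.add_one_le_exp (-(lswLambda (κ : ℝ) * s))
    simp only [hD]; linarith
  have hDlow : ∀ s, 0 < s → s ≤ L → F L - 1 ≤ D s := fun s hs hsL ↦ by
    have h1 := (exp_le_lswHit_two_pi hκ' hs).2
    have h2 := hFa hsL
    simp only [hD]; linarith
  -- as a primitive: `Φ(s) = ∫_s^{s+L} D`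
  have hshift : ∀ s, (∫ r in (0 : ℝ)..L, D (s + r)) = ∫ u in s..s + L, D u := fun s ↦ by
    rw [intervalIntegral.integral_comp_add_left D s, add_zero]
  refine ⟨?_, ?_, ?_, ?_⟩
  · have hprim := intervalIntegral.continuous_primitive hDi 0
    have heq : (fun s ↦ ∫ r in (0 : ℝ)..L, D (s + r)) = fun s ↦ (∫ u in (0 : ℝ)..s + L, D u) - ∫ u in (0 : ℝ)..s, D u := by
      funext s
      rw [hshift, intervalIntegral.integral_interval_sub_left (hDi _ _) (hDi _ _)]
    show Continuous fun s ↦ ∫ r in (0 : ℝ)..L, D (s + r)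
    rw [heq]
    exact (hprim.comp (continuous_id.add continuous_const)).sub hprim
  · intro s hs
    show (∫ r in (0 : ℝ)..L, D (s + r)) = 0
    rw [hshift]
    refine (intervalIntegral.integral_congr (g := fun _ ↦ (0 : ℝ)) fun u hu ↦ ?_).trans (by simp)
    rw [uIcc_of_le (by linarith)] at hu
    exact hD0 u (by linarith [hu.2])
  · intro s hs
    show (∫ r in (0 : ℝ)..L, D (s + r)) ≤ _
    rw [hshift]
    have h := intervalIntegral.integral_mono_on (by linarith : s ≤ s + L) (hDi _ _)
      (intervalIntegrable_const (c := lswLambda (κ : ℝ) * L)) fun u hu ↦ (show D u ≤ lswLambda (κ : ℝ) * L from by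
        rcases le_or_gt u 0 with hu0 | hu0
        · rw [hD0 u hu0]; positivity
        · exact (hDup u hu0).trans (mul_le_mul_of_nonneg_left (by linarith [hu.2, hs.2]) hlam.le))
    rw [intervalIntegral.integral_const, smul_eq_mul] at h
    calc _ ≤ (s + L - s) * (lswLambda (κ : ℝ) * L) := h
      _ = _ := by ring
  · intro s hs
    show _ ≤ ∫ r in (0 : ℝ)..L, D (s + r)
    rw [hshift]
    have h := intervalIntegral.integral_mono_on (by linarith : s ≤ s + L)
      (intervalIntegrable_const (c := F L - 1)) (hDi _ _) fun u hu ↦ (show F L - 1 ≤ D u from by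
        rcases le_or_gt u 0 with hu0 | hu0
        · rw [hD0 u hu0]; linarith [trace_le_one hFa hF1 L]
        · exact hDlow u hu0 (by linarith [hu.2, hs.2]))
    rw [intervalIntegral.integral_const, smul_eq_mul] at h
    calc -((1 - F L) * L) = (s + L - s) * (F L - 1) := by ring
      _ ≤ _ := h

/-- **Flatness transfer**: inside the strip, `topST κ Φ_L (θ, t) - Φ_L(t)` differs from the
flatness defect `R_L F(θ, t) - win_L F(t)` of the renewal extension of the window averages of `F`
exactly by the defect of `G`, which is `O(L (2π - θ)²) ≤ ε (2π - θ)^q` near `2π` (`t > 0`, `L ≥ 0`).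
[folklore] -/
theorem flat_transfer {L : ℝ} (hL : 0 ≤ L) {t : ℝ} (ht : 0 < t) {ε : ℝ} (hε : 0 < ε) :
    ∀ᶠ θ in 𝓝[<] (2 * Real.pi), θ ∈ Ioo 0 (2 * Real.pi) ∧
      |(topST κ (fun s ↦ ∫ r in (0 : ℝ)..L, (F (s + r) - lswHit κ (2 * Real.pi) (s + r))) θ t -
          ∫ r in (0 : ℝ)..L, (F (t + r) - lswHit κ (2 * Real.pi) (t + r))) -
        (renewalST κ (fun s ↦ ∫ r in (0 : ℝ)..L, bottomDatum (s + r)) (fun s ↦ ∫ r in (0 : ℝ)..L, F (s + r)) θ t -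
          ∫ r in (0 : ℝ)..L, F (t + r))| ≤ ε * (2 * Real.pi - θ) ^ lswQ (κ : ℝ) := by
  have hκ' : (4 : ℝ) < κ := by exact_mod_cast hκ
  have hq1 : lswQ (κ : ℝ) ≤ 1 := (lswQ_lt_one hκ').le
  obtain ⟨C, hC0, hC⟩ := abs_window_lswHit_sub_le hκ' ht
  have hFm : Measurable F := hFa.measurable
  have hGm : Measurable fun s ↦ lswHit κ (2 * Real.pi) s := (lswHit_two_pi_continuous hκ').measurable
  have hFb : ∀ s, |F s| ≤ 1 := fun s ↦ by rw [abs_of_nonneg (hF0 s)]; exact trace_le_one hFa hF1 s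
  have hGb : ∀ s, |lswHit κ (2 * Real.pi) s| ≤ 1 := fun s ↦ abs_lswHit_le_one hκ' _ _
  set δ : ℝ := min 1 (ε / (C * L + 1)) with hδ
  have hδ0 : 0 < δ := lt_min one_pos (by positivity)
  filter_upwards [Ioo_mem_nhdsLT (by linarith : 2 * Real.pi - δ < 2 * Real.pi)] with θ hθ
  set x : ℝ := 2 * Real.pi - θ with hx
  have hx0 : 0 < x := by rw [hx]; linarith [hθ.2]
  have hxδ : x < δ := by rw [hx]; linarith [hθ.1]
  have hx1 : x ≤ 1 := (hxδ.trans_le (min_le_left _ _)).le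
  have hxε : x ≤ ε / (C * L + 1) := (hxδ.trans_le (min_le_right _ _)).le
  have hθπ : θ ∈ Ioo Real.pi (2 * Real.pi) := ⟨by rw [hx] at hx1; linarith [Real.pi_gt_three], hθ.2⟩
  have hθ0 : θ ∈ Ioo 0 (2 * Real.pi) := ⟨by linarith [hθπ.1, Real.pi_pos], hθ.2⟩
  refine ⟨hθ0, ?_⟩
  have hTΦ := renewalST_window_sub hκ hFa hF1 hF0 hθ0 t hL
  have hRG := renewalST_window_lswHit hκ ⟨hθ0.1.le, hθ0.2.le⟩ t hL
  have hΦt : (∫ r in (0 : ℝ)..L, (F (t + r) - lswHit κ (2 * Real.pi) (t + r))) =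
      (∫ r in (0 : ℝ)..L, F (t + r)) - ∫ r in (0 : ℝ)..L, lswHit κ (2 * Real.pi) (t + r) :=
    intervalIntegral.integral_sub (intervalIntegrable_of_bdd (hFm.comp (measurable_const.add measurable_id))
      (fun r ↦ hFb _) 0 L) (intervalIntegrable_of_bdd (hGm.comp (measurable_const.add measurable_id))
      (fun r ↦ hGb _) 0 L)
  have hθm : Measurable fun r ↦ lswHit κ θ (t + r) :=
    (continuous_lswHit_of_mem hκ' ⟨hθ0.1, hθ0.2.le⟩).measurable.comp (measurable_const.add measurable_id)
  have hWint : (∫ r in (0 : ℝ)..L, (lswHit κ θ (t + r) - lswHit κ (2 * Real.pi) (t + r))) =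
      (∫ r in (0 : ℝ)..L, lswHit κ θ (t + r)) - ∫ r in (0 : ℝ)..L, lswHit κ (2 * Real.pi) (t + r) :=
    intervalIntegral.integral_sub (intervalIntegrable_of_bdd hθm (fun r ↦ abs_lswHit_le_one hκ' _ _) 0 L)
      (intervalIntegrable_of_bdd (hGm.comp (measurable_const.add measurable_id)) (fun r ↦ hGb _) 0 L)
  have key : (topST κ (fun s ↦ ∫ r in (0 : ℝ)..L, (F (s + r) - lswHit κ (2 * Real.pi) (s + r))) θ t -
        ∫ r in (0 : ℝ)..L, (F (t + r) - lswHit κ (2 * Real.pi) (t + r))) -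
      (renewalST κ (fun s ↦ ∫ r in (0 : ℝ)..L, bottomDatum (s + r)) (fun s ↦ ∫ r in (0 : ℝ)..L, F (s + r)) θ t -
        ∫ r in (0 : ℝ)..L, F (t + r)) =
      -((∫ r in (0 : ℝ)..L, lswHit κ θ (t + r)) - ∫ r in (0 : ℝ)..L, lswHit κ (2 * Real.pi) (t + r)) := by
    rw [← hTΦ, hRG, hΦt]; ring
  rw [key, abs_neg, ← hWint]
  have hW := hC θ hθπ L hL
  have hxq : x ≤ x ^ lswQ (κ : ℝ) := by
    have := Real.rpow_le_rpow_of_exponent_ge hx0 hx1 hq1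
    rwa [Real.rpow_one] at this
  have hx2 : x * (C * L + 1) ≤ ε := (le_div_iff₀ (by positivity)).1 hxε
  have hCLx : C * L * x ≤ ε := by nlinarith [hx0.le, hC0, hL]
  have hxq0 : 0 ≤ x ^ lswQ (κ : ℝ) := (Real.rpow_pos_of_pos hx0 _).le
  calc _ ≤ C * L * x ^ 2 := hW
    _ = C * L * x * x := by ring
    _ ≤ C * L * x * x ^ lswQ (κ : ℝ) := mul_le_mul_of_nonneg_left hxq (by positivity)
    _ ≤ ε * x ^ lswQ (κ : ℝ) := mul_le_mul_of_nonneg_right hCLx hxq0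

/-- **Upper bound for the window averages of `D`** (flatness from below, fixed `L ∈ (0, 1]`): for all
`t > 0`, `Φ_L(t) = ∫₀ᴸ D(t + r) dr ≤ λ L · L`. Otherwise `Φ_L` attains its maximum over `[-L, t₁]`
at a positive running record `t* > 0` (`Φ_L = 0` on `(-∞, -L]`, `Φ_L ≤ λ L²` on the band `[-L, 0]`),
where `no_pos_record` and `flat_transfer` give a contradiction. [folklore] -/
theorem window_sub_le {L : ℝ} (hL : 0 < L)
    (hflat : ∀ t : ℝ, 0 < t → ∀ ε : ℝ, 0 < ε → ∀ᶠ θ in 𝓝[<] (2 * Real.pi),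
      -(ε * (2 * Real.pi - θ) ^ lswQ (κ : ℝ)) ≤
        renewalST κ (fun s ↦ ∫ r in (0 : ℝ)..L, bottomDatum (s + r)) (fun s ↦ ∫ r in (0 : ℝ)..L, F (s + r)) θ t -
          ∫ r in (0 : ℝ)..L, F (t + r))
    {t : ℝ} (ht : 0 < t) :
    (∫ r in (0 : ℝ)..L, (F (t + r) - lswHit κ (2 * Real.pi) (t + r))) ≤ lswLambda (κ : ℝ) * L * L := by
  have hκ' : (4 : ℝ) < κ := by exact_mod_cast hκ
  obtain ⟨hcont, hzero, hband, -⟩ := window_sub_props hκ hFa hF1 hF0 hL.le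
  set Φ : ℝ → ℝ := fun s ↦ ∫ r in (0 : ℝ)..L, (F (s + r) - lswHit κ (2 * Real.pi) (s + r)) with hΦ
  have hΦm : Measurable Φ := hcont.measurable
  have hΦb : ∀ s, |Φ s| ≤ 1 * |L - 0| := fun s ↦ by
    have := intervalIntegral.norm_integral_le_of_norm_le_const (a := 0) (b := L) (C := 1)
      (f := fun r ↦ F (s + r) - lswHit κ (2 * Real.pi) (s + r)) fun r _ ↦ by
        rw [Real.norm_eq_abs]; exact abs_trace_sub_lswHit_le_one hκ hFa hF1 hF0 _
    rwa [Real.norm_eq_abs] at this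
  have hlam0 : 0 ≤ lswLambda (κ : ℝ) * L * L := by have := lswLambda_pos hκ'; positivity
  by_contra hgt
  push Not at hgt
  -- maximum of `Φ` on `[-L, t]`
  obtain ⟨tstar, hmem, hmax⟩ := (isCompact_Icc (a := -L) (b := t)).exists_isMaxOn
    (nonempty_Icc.2 (by linarith)) hcont.continuousOn
  rw [isMaxOn_iff] at hmax
  have hΦt : Φ t ≤ Φ tstar := hmax t ⟨by linarith, le_rfl⟩
  have hpos : 0 < Φ tstar := lt_of_le_of_lt hlam0 (hgt.trans_le hΦt)
  have htstar : 0 < tstar := by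
    by_contra h0
    push Not at h0
    have := hband tstar ⟨hmem.1, h0⟩
    linarith
  have hrec : ∀ s, s ≤ tstar → Φ s ≤ Φ tstar := fun s hs ↦ by
    rcases lt_or_ge s (-L) with hsL | hsL
    · rw [show Φ s = 0 from hzero s hsL.le]; exact hpos.le
    · exact hmax s ⟨hsL, hs.trans hmem.2⟩
  refine no_pos_record hκ hΦm hΦb hrec hpos fun ε hε ↦ ?_
  filter_upwards [hflat tstar htstar (ε / 2) (half_pos hε),
    flat_transfer hκ hFa hF1 hF0 hL.le htstar (half_pos hε)] with θ h1 h2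
  have h3 := (abs_le.1 h2.2).1
  simp only [hΦ]
  linarith

/-- **Lower bound for the window averages of `D`** (flatness from above): for all `t > 0`,
`Φ_L(t) ≥ -(1 - F(L)) L` (minimum over `[-L, t₁]`, `no_neg_record`). [folklore] -/
theorem le_window_sub {L : ℝ} (hL : 0 < L)
    (hflat : ∀ t : ℝ, 0 < t → ∀ ε : ℝ, 0 < ε → ∀ᶠ θ in 𝓝[<] (2 * Real.pi),
      renewalST κ (fun s ↦ ∫ r in (0 : ℝ)..L, bottomDatum (s + r)) (fun s ↦ ∫ r in (0 : ℝ)..L, F (s + r)) θ t -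
          ∫ r in (0 : ℝ)..L, F (t + r) ≤ ε * (2 * Real.pi - θ) ^ lswQ (κ : ℝ))
    {t : ℝ} (ht : 0 < t) :
    -((1 - F L) * L) ≤ ∫ r in (0 : ℝ)..L, (F (t + r) - lswHit κ (2 * Real.pi) (t + r)) := by
  have hκ' : (4 : ℝ) < κ := by exact_mod_cast hκ
  obtain ⟨hcont, hzero, -, hband⟩ := window_sub_props hκ hFa hF1 hF0 hL.le
  set Φ : ℝ → ℝ := fun s ↦ ∫ r in (0 : ℝ)..L, (F (s + r) - lswHit κ (2 * Real.pi) (s + r)) with hΦ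
  have hΦm : Measurable Φ := hcont.measurable
  have hΦb : ∀ s, |Φ s| ≤ 1 * |L - 0| := fun s ↦ by
    have := intervalIntegral.norm_integral_le_of_norm_le_const (a := 0) (b := L) (C := 1)
      (f := fun r ↦ F (s + r) - lswHit κ (2 * Real.pi) (s + r)) fun r _ ↦ by
        rw [Real.norm_eq_abs]; exact abs_trace_sub_lswHit_le_one hκ hFa hF1 hF0 _
    rwa [Real.norm_eq_abs] at this
  have hF1L : 0 ≤ (1 - F L) * L := mul_nonneg (sub_nonneg.2 (trace_le_one hFa hF1 L)) hL.le
  by_contra hlt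
  push Not at hlt
  obtain ⟨tstar, hmem, hmin⟩ := (isCompact_Icc (a := -L) (b := t)).exists_isMinOn
    (nonempty_Icc.2 (by linarith)) hcont.continuousOn
  rw [isMinOn_iff] at hmin
  have hΦt : Φ tstar ≤ Φ t := hmin t ⟨by linarith, le_rfl⟩
  have hneg : Φ tstar < 0 := lt_of_le_of_lt hΦt (hlt.trans_le (neg_nonpos.2 hF1L))
  have htstar : 0 < tstar := by
    by_contra h0
    push Not at h0
    have := hband tstar ⟨hmem.1, h0⟩
    linarith
  have hrec : ∀ s, s ≤ tstar → Φ tstar ≤ Φ s := fun s hs ↦ by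
    rcases lt_or_ge s (-L) with hsL | hsL
    · rw [show Φ s = 0 from hzero s hsL.le]; exact hneg.le
    · exact hmin s ⟨hsL, hs.trans hmem.2⟩
  refine no_neg_record hκ hΦm hΦb hrec hneg fun ε hε ↦ ?_
  filter_upwards [hflat tstar htstar (ε / 2) (half_pos hε),
    flat_transfer hκ hFa hF1 hF0 hL.le htstar (half_pos hε)] with θ h1 h2
  have h3 := (abs_le.1 h2.2).2
  simp only [hΦ]
  linarith

/-- **Upper identification `F ≤ u(2π, ·)` from flatness from below.** Let `κ > 4` and
`F : ℝ → [0, 1]` be antitone with `F = 1` on `(-∞, 0]`. If for every window length `L ∈ (0, 1)`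
and every `t > 0` the renewal extension of the window averages of `F` (bottom data `1_{≤ 0}`) is
flat FROM BELOW at `θ = 2π` to order `o((2π - θ)^q)` —
`liminf_{θ↑2π} (renewalST κ (win_L 1_{≤0}) (win_L F) θ t - win_L F(t)) / (2π - θ)^q ≥ 0` — then
`F(t) ≤ u(2π, t)` for all `t > 0`. For LSW's hitting function this one-sided condition is their
Lemma 2.3 (and already its `o((2π - θ)^q)` weakening), the other side being free (`Q(θ) ⊆ Q(2π)`).
[cite: LawlerSchrammWernerEJP2002, §2 (2.10), Lemma 2.3 (2.12)] -/
theorem le_lswHit_two_pi_of_flat_below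
    (hflat : ∀ L ∈ Ioo (0 : ℝ) 1, ∀ t : ℝ, 0 < t → ∀ ε : ℝ, 0 < ε → ∀ᶠ θ in 𝓝[<] (2 * Real.pi),
      -(ε * (2 * Real.pi - θ) ^ lswQ (κ : ℝ)) ≤
        renewalST κ (fun s ↦ ∫ r in (0 : ℝ)..L, bottomDatum (s + r)) (fun s ↦ ∫ r in (0 : ℝ)..L, F (s + r)) θ t -
          ∫ r in (0 : ℝ)..L, F (t + r))
    {t : ℝ} (ht : 0 < t) : F t ≤ lswHit κ (2 * Real.pi) t := by
  have hκ' : (4 : ℝ) < κ := by exact_mod_cast hκ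
  have hlam : 0 < lswLambda (κ : ℝ) := lswLambda_pos hκ'
  set G : ℝ → ℝ := fun s ↦ lswHit κ (2 * Real.pi) s with hG
  have hGc : Continuous G := lswHit_two_pi_continuous hκ'
  have hFm : Measurable F := hFa.measurable
  have hFb : ∀ s, |F s| ≤ 1 := fun s ↦ by rw [abs_of_nonneg (hF0 s)]; exact trace_le_one hFa hF1 s
  have hGb : ∀ s, |G s| ≤ 1 := fun s ↦ abs_lswHit_le_one hκ' _ _
  by_contra hgt
  push Not at hgt
  set d : ℝ := F t - G t with hd
  have hd0 : 0 < d := sub_pos.2 hgt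
  -- continuity of `G` at `t`
  obtain ⟨η, hη, hGη⟩ := Metric.continuous_iff.1 hGc t (d / 3) (by positivity)
  -- the window length
  set L : ℝ := min (min (1 / 2) (t / 2)) (min (η / 2) (d / (3 * (lswLambda (κ : ℝ) + 1)))) with hL
  have hL0 : 0 < L := by simp only [hL]; positivity
  have hL1 : L < 1 := by
    have : L ≤ 1 / 2 := (min_le_left _ _).trans (min_le_left _ _); linarith
  have hLt : L < t := by
    have : L ≤ t / 2 := (min_le_left _ _).trans (min_le_right _ _); linarith
  have hLη : L < η := by
    have : L ≤ η / 2 := (min_le_right _ _).trans (min_le_left _ _); linarith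
  have hLd : lswLambda (κ : ℝ) * L < d / 3 := by
    have h1 : L ≤ d / (3 * (lswLambda (κ : ℝ) + 1)) := (min_le_right _ _).trans (min_le_right _ _)
    have h2 : lswLambda (κ : ℝ) * L ≤ lswLambda (κ : ℝ) * (d / (3 * (lswLambda (κ : ℝ) + 1))) :=
      mul_le_mul_of_nonneg_left h1 hlam.le
    have h3 : lswLambda (κ : ℝ) * (d / (3 * (lswLambda (κ : ℝ) + 1))) < d / 3 := by
      rw [mul_div_assoc', div_lt_div_iff₀ (by positivity) (by positivity)]
      nlinarith
    linarith
  -- the window bound at `t - L > 0`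
  have hwin := window_sub_le hκ hFa hF1 hF0 hL0 (hflat L ⟨hL0, hL1⟩) (t := t - L) (by linarith)
  have hFi : IntervalIntegrable (fun r ↦ F (t - L + r)) volume 0 L :=
    intervalIntegrable_of_bdd (hFm.comp (measurable_const.add measurable_id)) (fun r ↦ hFb _) 0 L
  have hGi : IntervalIntegrable (fun r ↦ G (t - L + r)) volume 0 L :=
    intervalIntegrable_of_bdd (hGc.measurable.comp (measurable_const.add measurable_id)) (fun r ↦ hGb _) 0 L
  rw [intervalIntegral.integral_sub hFi hGi] at hwin
  -- `∫₀ᴸ F(t - L + r) ≥ L F(t)` and `∫₀ᴸ G(t - L + r) ≤ L (G t + d/3)`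
  have hF_low : L * F t ≤ ∫ r in (0 : ℝ)..L, F (t - L + r) := by
    have h := intervalIntegral.integral_mono_on hL0.le (intervalIntegrable_const (c := F t)) hFi
      fun r hr ↦ (show F t ≤ F (t - L + r) from hFa (by linarith [hr.2]))
    rwa [intervalIntegral.integral_const, smul_eq_mul, sub_zero] at h
  have hG_up : (∫ r in (0 : ℝ)..L, G (t - L + r)) ≤ L * (G t + d / 3) := by
    have h := intervalIntegral.integral_mono_on hL0.le hGi (intervalIntegrable_const (c := G t + d / 3))
      fun r hr ↦ (show G (t - L + r) ≤ G t + d / 3 from by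
        have := hGη (t - L + r) (by rw [Real.dist_eq, abs_lt]; constructor <;> linarith [hr.1, hr.2])
        rw [Real.dist_eq, abs_lt] at this
        linarith)
    rwa [intervalIntegral.integral_const, smul_eq_mul, sub_zero] at h
  have : L * F t - L * (G t + d / 3) ≤ lswLambda (κ : ℝ) * L * L := by linarith
  have h5 : F t - (G t + d / 3) ≤ lswLambda (κ : ℝ) * L := by
    exact le_of_mul_le_mul_left (show L * (F t - (G t + d / 3)) ≤ L * (lswLambda (κ : ℝ) * L) by nlinarith) hL0
  simp only [hd] at hLd
  linarith

/-- **Lower identification `u(2π, ·) ≤ F` from flatness from above and `F(0+) = 1`.** With `F` as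
above and `F(t) → 1` as `t ↓ 0`, if for every `L ∈ (0, 1)`, `t > 0`,
`limsup_{θ↑2π} (renewalST κ (win_L 1_{≤0}) (win_L F) θ t - win_L F(t)) / (2π - θ)^q ≤ 0`, then
`u(2π, t) ≤ F(t)` for all `t > 0`. For LSW's hitting function the condition holds trivially
(`h(θ, ·) ≤ h(2π, ·)` since `Q(θ) ⊆ Q(2π)`). [cite: LawlerSchrammWernerEJP2002, §2 (2.10), Lemma 2.3] -/
theorem lswHit_two_pi_le_of_flat_above (hF0plus : Tendsto F (𝓝[>] 0) (𝓝 1))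
    (hflat : ∀ L ∈ Ioo (0 : ℝ) 1, ∀ t : ℝ, 0 < t → ∀ ε : ℝ, 0 < ε → ∀ᶠ θ in 𝓝[<] (2 * Real.pi),
      renewalST κ (fun s ↦ ∫ r in (0 : ℝ)..L, bottomDatum (s + r)) (fun s ↦ ∫ r in (0 : ℝ)..L, F (s + r)) θ t -
          ∫ r in (0 : ℝ)..L, F (t + r) ≤ ε * (2 * Real.pi - θ) ^ lswQ (κ : ℝ))
    {t : ℝ} (ht : 0 < t) : lswHit κ (2 * Real.pi) t ≤ F t := by
  have hκ' : (4 : ℝ) < κ := by exact_mod_cast hκ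
  set G : ℝ → ℝ := fun s ↦ lswHit κ (2 * Real.pi) s with hG
  have hGc : Continuous G := lswHit_two_pi_continuous hκ'
  have hFm : Measurable F := hFa.measurable
  have hFb : ∀ s, |F s| ≤ 1 := fun s ↦ by rw [abs_of_nonneg (hF0 s)]; exact trace_le_one hFa hF1 s
  have hGb : ∀ s, |G s| ≤ 1 := fun s ↦ abs_lswHit_le_one hκ' _ _
  by_contra hlt
  push Not at hlt
  set d : ℝ := G t - F t with hd
  have hd0 : 0 < d := sub_pos.2 hlt
  obtain ⟨η, hη, hGη⟩ := Metric.continuous_iff.1 hGc t (d / 3) (by positivity)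
  -- `F(L) > 1 - d/3` for small `L > 0`
  have hev : ∀ᶠ L in 𝓝[>] (0 : ℝ), 1 - d / 3 < F L := hF0plus (Ioi_mem_nhds (by linarith))
  rw [eventually_nhdsWithin_iff, Metric.eventually_nhds_iff] at hev
  obtain ⟨ρ, hρ, hFρ⟩ := hev
  set L : ℝ := min (1 / 2) (min (η / 2) (ρ / 2)) with hL
  have hL0 : 0 < L := by simp only [hL]; positivity
  have hL1 : L < 1 := by have : L ≤ 1 / 2 := min_le_left _ _; linarith
  have hLη : L < η := by have : L ≤ η / 2 := (min_le_right _ _).trans (min_le_left _ _); linarith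
  have hLρ : L < ρ := by have : L ≤ ρ / 2 := (min_le_right _ _).trans (min_le_right _ _); linarith
  have hFL : 1 - d / 3 < F L := hFρ (by rw [Real.dist_eq, sub_zero, abs_of_pos hL0]; exact hLρ) hL0
  have hwin := le_window_sub hκ hFa hF1 hF0 hL0 (hflat L ⟨hL0, hL1⟩) ht
  have hFi : IntervalIntegrable (fun r ↦ F (t + r)) volume 0 L :=
    intervalIntegrable_of_bdd (hFm.comp (measurable_const.add measurable_id)) (fun r ↦ hFb _) 0 L
  have hGi : IntervalIntegrable (fun r ↦ G (t + r)) volume 0 L :=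
    intervalIntegrable_of_bdd (hGc.measurable.comp (measurable_const.add measurable_id)) (fun r ↦ hGb _) 0 L
  rw [intervalIntegral.integral_sub hFi hGi] at hwin
  have hF_up : (∫ r in (0 : ℝ)..L, F (t + r)) ≤ L * F t := by
    have h := intervalIntegral.integral_mono_on hL0.le hFi (intervalIntegrable_const (c := F t))
      fun r hr ↦ (show F (t + r) ≤ F t from hFa (by linarith [hr.1]))
    rwa [intervalIntegral.integral_const, smul_eq_mul, sub_zero] at h
  have hG_low : L * (G t - d / 3) ≤ ∫ r in (0 : ℝ)..L, G (t + r) := by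
    have h := intervalIntegral.integral_mono_on hL0.le (intervalIntegrable_const (c := G t - d / 3)) hGi
      fun r hr ↦ (show G t - d / 3 ≤ G (t + r) from by
        have := hGη (t + r) (by rw [Real.dist_eq, abs_lt]; constructor <;> linarith [hr.1, hr.2])
        rw [Real.dist_eq, abs_lt] at this
        linarith)
    rwa [intervalIntegral.integral_const, smul_eq_mul, sub_zero] at h
  have h4 : -((1 - F L) * L) ≤ L * F t - L * (G t - d / 3) := by linarith
  have h5 : -(1 - F L) ≤ F t - (G t - d / 3) := by
    exact le_of_mul_le_mul_left (show L * (-(1 - F L)) ≤ L * (F t - (G t - d / 3)) by nlinarith) hL0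
  simp only [hd] at hFL
  linarith

/-- **Identification from two-sided flatness**: `κ > 4`, `F : ℝ → [0, 1]` antitone, `F = 1` on
`(-∞, 0]`, `F(0+) = 1`; if for every `L ∈ (0, 1)`, `t > 0` and `ε > 0`, eventually as `θ ↑ 2π`,
`|renewalST κ (win_L 1_{≤0}) (win_L F) θ t - win_L F(t)| ≤ ε (2π - θ)^q`, then `F = u(2π, ·)` on
`(0, ∞)`: the renewal extension of LSW's (2.10) together with (an `o((2π - θ)^q)` weakening of) the
Neumann condition (2.12) of the window averages DETERMINES the trace, and it is the trace of the
series solution `lswHit κ`. [cite: LawlerSchrammWernerEJP2002, §2 (2.10), Lemma 2.2, Lemma 2.3 (2.12)] -/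
theorem eq_lswHit_two_pi_of_flat (hF0plus : Tendsto F (𝓝[>] 0) (𝓝 1))
    (hflat : ∀ L ∈ Ioo (0 : ℝ) 1, ∀ t : ℝ, 0 < t → ∀ ε : ℝ, 0 < ε → ∀ᶠ θ in 𝓝[<] (2 * Real.pi),
      |renewalST κ (fun s ↦ ∫ r in (0 : ℝ)..L, bottomDatum (s + r)) (fun s ↦ ∫ r in (0 : ℝ)..L, F (s + r)) θ t -
          ∫ r in (0 : ℝ)..L, F (t + r)| ≤ ε * (2 * Real.pi - θ) ^ lswQ (κ : ℝ))
    {t : ℝ} (ht : 0 < t) : F t = lswHit κ (2 * Real.pi) t :=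
  le_antisymm
    (le_lswHit_two_pi_of_flat_below hκ hFa hF1 hF0 (fun L hL t ht ε hε ↦
      (hflat L hL t ht ε hε).mono fun _ h ↦ (abs_le.1 h).1) ht)
    (lswHit_two_pi_le_of_flat_above hκ hFa hF1 hF0 hF0plus (fun L hL t ht ε hε ↦
      (hflat L hL t ht ε hε).mono fun _ h ↦ (abs_le.1 h).2) ht)

/-- **Domination forces `F(0+) = 1`.** If `renewalST κ 1_{≤0} F θ₀ s ≤ F(s)` for all `s`, at one
interior angle `θ₀`, then `F(s) ≥ P^{θ₀}[T ≥ s] → 1` as `s ↓ 0` (on `{T ≥ s}` both data equal `1`;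
`T > 0` a.s.). [folklore] -/
theorem tendsto_one_of_renewalST_le {θ₀ : ℝ} (hθ₀ : θ₀ ∈ Ioo 0 (2 * Real.pi))
    (hdom : ∀ s : ℝ, renewalST κ bottomDatum F θ₀ s ≤ F s) : Tendsto F (𝓝[>] 0) (𝓝 1) := by
  haveI := isProbabilityMeasure_preWienerMeasure'
  have hc := continuous_sleDriving' κ
  have hFm : Measurable F := hFa.measurable
  have hFb : ∀ s, |F s| ≤ 1 := fun s ↦ by rw [abs_of_nonneg (hF0 s)]; exact trace_le_one hFa hF1 s
  -- `P[s ≤ T] ≤ F(s)`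
  have hlow : ∀ s : ℝ, preWienerMeasure.real {ω | s ≤ sleLifetimeReal κ θ₀ ω} ≤ F s := by
    intro s
    refine le_trans ?_ (hdom s)
    rw [renewalST_of_mem κ _ _ hθ₀]
    unfold botST topST botExpect topExpect
    have hib : Integrable (fun ω ↦ (sleExitsBot κ θ₀).indicator (fun ω ↦ bottomDatum (s - sleLifetimeReal κ θ₀ ω)) ω)
        preWienerMeasure := by
      refine integrable_of_abs_le (measurable_indicator_bottomDatum s) (C := 1) fun ω ↦ ?_
      by_cases hω : ω ∈ sleExitsBot κ θ₀
      · rw [indicator_of_mem hω]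
        have := bottomDatum_mem_Icc (s - sleLifetimeReal κ θ₀ ω)
        rw [abs_of_nonneg this.1]; exact this.2
      · rw [indicator_of_notMem hω, abs_zero]; exact zero_le_one
    have hit := integrable_indicator_top (κ := κ) hFm hFb θ₀ s
    rw [← integral_add hib hit, ← integral_indicator_one
      (measurableSet_le measurable_const (measurable_sleLifetimeReal κ θ₀))]
    refine integral_mono_ae ((integrable_const (1 : ℝ)).indicator
      (measurableSet_le measurable_const (measurable_sleLifetimeReal κ θ₀))) (hib.add hit) ?_
    filter_upwards [ae_mem_sleExitsTop_or_sleExitsBot hκ hθ₀] with ω hside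
    by_cases hs : s ≤ sleLifetimeReal κ θ₀ ω
    · have hmem : ω ∈ {ω | s ≤ sleLifetimeReal κ θ₀ ω} := hs
      rw [indicator_of_mem hmem, Pi.one_apply]
      have hb : bottomDatum (s - sleLifetimeReal κ θ₀ ω) = 1 := by rw [bottomDatum, if_pos (by linarith)]
      have hF : F (s - sleLifetimeReal κ θ₀ ω) = 1 := hF1 _ (by linarith)
      rcases hside with htop | hbot
      · rw [indicator_of_mem htop, hF]
        have h0 : 0 ≤ (sleExitsBot κ θ₀).indicator (fun ω ↦ bottomDatum (s - sleLifetimeReal κ θ₀ ω)) ω := by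
          by_cases hω : ω ∈ sleExitsBot κ θ₀
          · rw [indicator_of_mem hω]; exact (bottomDatum_mem_Icc _).1
          · rw [indicator_of_notMem hω]
        linarith
      · rw [indicator_of_mem hbot, hb]
        have h0 : 0 ≤ (sleExitsTop κ θ₀).indicator (fun ω ↦ F (s - sleLifetimeReal κ θ₀ ω)) ω := by
          by_cases hω : ω ∈ sleExitsTop κ θ₀
          · rw [indicator_of_mem hω]; exact hF0 _
          · rw [indicator_of_notMem hω]
        linarith
    · have hnmem : ω ∉ {ω | s ≤ sleLifetimeReal κ θ₀ ω} := hs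
      rw [indicator_of_notMem hnmem]
      refine add_nonneg ?_ ?_
      · by_cases hω : ω ∈ sleExitsBot κ θ₀
        · rw [indicator_of_mem hω]; exact (bottomDatum_mem_Icc _).1
        · rw [indicator_of_notMem hω]
      · by_cases hω : ω ∈ sleExitsTop κ θ₀
        · rw [indicator_of_mem hω]; exact hF0 _
        · rw [indicator_of_notMem hω]
  -- `P[1/(n+1) ≤ T] → P[0 < T] = 1`
  set A : ℕ → Set (ℝ≥0 → ℝ) := fun n ↦ {ω | 1 / ((n : ℝ) + 1) ≤ sleLifetimeReal κ θ₀ ω} with hA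
  have hmono : Monotone A := by
    intro n m hnm ω hω
    have hω' : 1 / ((n : ℝ) + 1) ≤ sleLifetimeReal κ θ₀ ω := hω
    show 1 / ((m : ℝ) + 1) ≤ sleLifetimeReal κ θ₀ ω
    have : 1 / ((m : ℝ) + 1) ≤ 1 / ((n : ℝ) + 1) :=
      one_div_le_one_div_of_le (by positivity) (by exact_mod_cast Nat.succ_le_succ hnm)
    exact this.trans hω'
  have hunion : preWienerMeasure (⋃ n, A n) = 1 := by
    have hae : ∀ᵐ ω ∂preWienerMeasure, ω ∈ ⋃ n, A n := by
      obtain ⟨N, hN⟩ := eventually_mem_Ioo_level hθ₀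
      filter_upwards [ae_sleLifetime_lt_top (θ := θ₀) hκ] with ω hT
      obtain ⟨T₀, hT₀⟩ := WithTop.ne_top_iff_exists.1 hT.ne
      have hTreal : sleLifetimeReal κ θ₀ ω = T₀ := sleLifetimeReal_of_eq_coe hT₀.symm
      have hpos : 0 < (T₀ : ℝ) := by
        have h1 := truncExit_pos hc (level_pos N) (level_le N) (hN N le_rfl) ω
        have h2 := exitLevel_le_lifetime hc N θ₀ ω
        have h3 : (0 : WithTop ℝ≥0) < sleLifetime κ θ₀ ω := lt_of_lt_of_le h1 h2
        rw [← hT₀] at h3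
        have : (0 : ℝ≥0) < T₀ := by exact_mod_cast h3
        exact_mod_cast this
      obtain ⟨n, hn⟩ := exists_nat_one_div_lt hpos
      exact mem_iUnion.2 ⟨n, by show 1 / ((n : ℝ) + 1) ≤ sleLifetimeReal κ θ₀ ω; rw [hTreal]; exact hn.le⟩
    rw [← measure_univ (μ := preWienerMeasure)]
    refine measure_congr ?_
    rw [ae_eq_univ]
    rw [ae_iff] at hae
    exact hae
  have hlim : Tendsto (fun n ↦ preWienerMeasure.real (A n)) atTop (𝓝 1) := by
    have h := tendsto_measure_iUnion_atTop (μ := preWienerMeasure) hmono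
    rw [hunion] at h
    have h2 := (ENNReal.tendsto_toReal ENNReal.one_ne_top).comp h
    rw [ENNReal.toReal_one] at h2
    exact h2
  -- conclude
  rw [tendsto_order]
  refine ⟨fun a ha ↦ ?_, fun b hb ↦ Eventually.of_forall fun s ↦ (trace_le_one hFa hF1 s).trans_lt hb⟩
  obtain ⟨n, hn⟩ := (hlim.eventually (Ioi_mem_nhds ha)).exists
  filter_upwards [Ioo_mem_nhdsGT (by positivity : (0 : ℝ) < 1 / ((n : ℝ) + 1))] with s hs
  have hsub : A n ⊆ {ω | s ≤ sleLifetimeReal κ θ₀ ω} := fun ω (hω : _ ≤ _) ↦ le_trans hs.2.le hω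
  calc a < preWienerMeasure.real (A n) := hn
    _ ≤ preWienerMeasure.real {ω | s ≤ sleLifetimeReal κ θ₀ ω} := measureReal_mono hsub
    _ ≤ F s := hlow s

omit hκ in
/-- **The free side.** If the renewal extension of `F` itself is dominated by `F`,
`renewalST κ 1_{≤0} F θ s ≤ F(s)` for `θ ∈ (0, 2π)` and all `s` (for LSW's hitting function:
`h(θ, ·) ≤ h(2π, ·)` because `Q(θ) ⊆ Q(2π)`), then the renewal extensions of the window averages
are flat from above at `2π` in the sense of `lswHit_two_pi_le_of_flat_above` (indeed
`≤ win_L F(t)`), by `renewalST_window`. [cite: LawlerSchrammWernerEJP2002, §2 (2.10) and proof of Thm. 1.2] -/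
theorem flat_above_of_renewalST_le
    (hdom : ∀ θ ∈ Ioo 0 (2 * Real.pi), ∀ s : ℝ, renewalST κ bottomDatum F θ s ≤ F s)
    {L : ℝ} (hL : 0 ≤ L) (t : ℝ) {ε : ℝ} (hε : 0 ≤ ε) :
    ∀ᶠ θ in 𝓝[<] (2 * Real.pi),
      renewalST κ (fun s ↦ ∫ r in (0 : ℝ)..L, bottomDatum (s + r)) (fun s ↦ ∫ r in (0 : ℝ)..L, F (s + r)) θ t -
          ∫ r in (0 : ℝ)..L, F (t + r) ≤ ε * (2 * Real.pi - θ) ^ lswQ (κ : ℝ) := by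
  have hFm : Measurable F := hFa.measurable
  have hFb : ∀ s, |F s| ≤ 1 := fun s ↦ by rw [abs_of_nonneg (hF0 s)]; exact trace_le_one hFa hF1 s
  have hbb : ∀ s, |bottomDatum s| ≤ 1 := fun s ↦ by
    have := bottomDatum_mem_Icc s; rw [abs_of_nonneg this.1]; exact this.2
  filter_upwards [Ioo_mem_nhdsLT (by positivity : (0 : ℝ) < 2 * Real.pi)] with θ hθ
  have hx : 0 ≤ ε * (2 * Real.pi - θ) ^ lswQ (κ : ℝ) :=
    mul_nonneg hε (Real.rpow_nonneg (by linarith [hθ.2]) _)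
  rw [renewalST_window κ measurable_bottomDatum hFm hbb hFb θ t hL]
  have hmono : (∫ r in (0 : ℝ)..L, renewalST κ bottomDatum F θ (t + r)) ≤ ∫ r in (0 : ℝ)..L, F (t + r) := by
    refine intervalIntegral.integral_mono_on hL ?_
      (intervalIntegrable_of_bdd (hFm.comp (measurable_const.add measurable_id)) (fun r ↦ hFb _) 0 L)
      fun r _ ↦ hdom θ hθ (t + r)
    -- integrability of the renewal extension along the window: it is `botST + topST` of bounded data
    have h1 := (botST_window κ measurable_bottomDatum hbb θ t hL).2
    have h2 := (topST_window κ hFm hFb θ t hL).2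
    exact (h1.add h2).congr fun r _ ↦ (renewalST_of_mem κ _ _ hθ (t + r)).symm
  linarith

/-- **Lower identification from domination alone**: `κ > 4`, `F : ℝ → [0, 1]` antitone, `F = 1` on
`(-∞, 0]`, and `renewalST κ 1_{≤0} F θ s ≤ F(s)` on `(0, 2π) × ℝ`; then `u(2π, t) ≤ F(t)` for
`t > 0` (`F(0+) = 1` is forced by the domination, `tendsto_one_of_renewalST_le`). For LSW's hitting
function the domination is `Q(θ) ⊆ Q(2π)`, so the lower bound `h(2π, t) ≥ u(2π, t)` of the
identification needs (2.10) only, no Lemma 2.3 — matching `OneArmComparisonOneSided` for Thm. 1.2.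
[cite: LawlerSchrammWernerEJP2002, §2 (2.10) and proof of Thm. 1.2] -/
theorem lswHit_two_pi_le_of_renewalST_le
    (hdom : ∀ θ ∈ Ioo 0 (2 * Real.pi), ∀ s : ℝ, renewalST κ bottomDatum F θ s ≤ F s)
    {t : ℝ} (ht : 0 < t) : lswHit κ (2 * Real.pi) t ≤ F t :=
  lswHit_two_pi_le_of_flat_above hκ hFa hF1 hF0
    (tendsto_one_of_renewalST_le hκ hFa hF1 hF0 ⟨Real.pi_pos, by linarith [Real.pi_pos]⟩ (hdom Real.pi
      ⟨Real.pi_pos, by linarith [Real.pi_pos]⟩))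
    (fun _ hL t _ _ hε ↦ flat_above_of_renewalST_le hFa hF1 hF0 hdom hL.1.le t hε.le) ht

/-- **Identification from domination and flatness from below** — the hypothesis set of LSW's own
argument: `renewalST κ 1_{≤0} F ≤ F` on `(0, 2π) × ℝ` ((2.10) + `Q(θ) ⊆ Q(2π)`) and, for the
renewal extensions of the window averages, flatness FROM BELOW at `2π` to order `o((2π - θ)^q)`
(Lemma 2.3, weakened); then `F = u(2π, ·)` on `(0, ∞)`. [cite: LawlerSchrammWernerEJP2002, §2 (2.10), Lemma 2.3 (2.12), proof of Thm. 1.2] -/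
theorem eq_lswHit_two_pi_of_renewal
    (hdom : ∀ θ ∈ Ioo 0 (2 * Real.pi), ∀ s : ℝ, renewalST κ bottomDatum F θ s ≤ F s)
    (hflat : ∀ L ∈ Ioo (0 : ℝ) 1, ∀ t : ℝ, 0 < t → ∀ ε : ℝ, 0 < ε → ∀ᶠ θ in 𝓝[<] (2 * Real.pi),
      -(ε * (2 * Real.pi - θ) ^ lswQ (κ : ℝ)) ≤
        renewalST κ (fun s ↦ ∫ r in (0 : ℝ)..L, bottomDatum (s + r)) (fun s ↦ ∫ r in (0 : ℝ)..L, F (s + r)) θ t -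
          ∫ r in (0 : ℝ)..L, F (t + r))
    {t : ℝ} (ht : 0 < t) : F t = lswHit κ (2 * Real.pi) t :=
  le_antisymm (le_lswHit_two_pi_of_flat_below hκ hFa hF1 hF0 hflat ht)
    (lswHit_two_pi_le_of_renewalST_le hκ hFa hF1 hF0 hdom ht)

end Identification

/-! ### Consequences for the named fact (`κ = 6`) -/

/-- `q = 1/3` for `κ = 6` in `ℝ≥0` form. [folklore] -/
theorem lswQ_coe_six : lswQ ((6 : ℝ≥0) : ℝ) = 1 / 3 := by
  rw [show ((6 : ℝ≥0) : ℝ) = 6 by norm_num]; exact lswQ_six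

/-- **The trace identification at one probability measure.** For a probability measure `ν` on
non-empty compacts of `ℂ`, let `w_ν(t) = ν{K | 𝔯(K) ≤ e^{-t}}` (antitone, `= 1` for `t ≤ 0` by
Schwarz, `𝔯 ≤ 1`). If `w_ν(0+) = 1` and, for every `L ∈ (0, 1)`, `t > 0`, `ε > 0`, eventually as
`θ ↑ 2π`, `|renewalST 6 (win_L 1_{≤0}) (win_L w_ν) θ t - win_L w_ν(t)| ≤ ε (2π - θ)^{1/3}`, then
`u(2π, t) = w_ν(t)` for all `t > 0` (`u = lswHit 6`; `eq_lswHit_two_pi_of_flat`). For the (sub)sequential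
weak limits `ν` of `lswLaw` the hypothesis is what LSW's (2.10) for the arc hitting function
(Thm. 2.1 + radial `SLE₆`) and Lemma 2.3 provide. [cite: LawlerSchrammWernerEJP2002, §2: Thm. 2.1, (2.2), (2.10), Lemma 2.3] -/
theorem lswHit_two_pi_eq_measureReal_of_renewalFlat (ν : ProbabilityMeasure (TopologicalSpace.NonemptyCompacts ℂ))
    (h0 : Tendsto (fun s : ℝ ↦ (ν : Measure (TopologicalSpace.NonemptyCompacts ℂ)).real
        {K | Literature.Analysis.Complex.conformalRadius (K : Set ℂ) ≤ Real.exp (-s)}) (𝓝[>] 0) (𝓝 1))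
    (hfl : ∀ L ∈ Ioo (0 : ℝ) 1, ∀ t : ℝ, 0 < t → ∀ ε : ℝ, 0 < ε → ∀ᶠ θ in 𝓝[<] (2 * Real.pi),
        |renewalST 6 (fun s ↦ ∫ r in (0 : ℝ)..L, bottomDatum (s + r))
            (fun s ↦ ∫ r in (0 : ℝ)..L, (ν : Measure (TopologicalSpace.NonemptyCompacts ℂ)).real
              {K | Literature.Analysis.Complex.conformalRadius (K : Set ℂ) ≤ Real.exp (-(s + r))}) θ t -
          ∫ r in (0 : ℝ)..L, (ν : Measure (TopologicalSpace.NonemptyCompacts ℂ)).real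
              {K | Literature.Analysis.Complex.conformalRadius (K : Set ℂ) ≤ Real.exp (-(t + r))}|
          ≤ ε * (2 * Real.pi - θ) ^ (1 / 3 : ℝ))
    {t : ℝ} (ht : 0 < t) :
    lswHit 6 (2 * Real.pi) t = (ν : Measure (TopologicalSpace.NonemptyCompacts ℂ)).real
      {K | Literature.Analysis.Complex.conformalRadius (K : Set ℂ) ≤ Real.exp (-t)} := by
  set w : ℝ → ℝ := fun s ↦ (ν : Measure (TopologicalSpace.NonemptyCompacts ℂ)).real
    {K | Literature.Analysis.Complex.conformalRadius (K : Set ℂ) ≤ Real.exp (-s)} with hw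
  have hwa : Antitone w := fun a b hab ↦ by
    simp only [hw]
    exact measureReal_mono (fun K (hK : _ ≤ _) ↦ hK.trans (Real.exp_le_exp.2 (neg_le_neg hab)))
  have hw1 : ∀ s, s ≤ 0 → w s = 1 := fun s hs ↦ by
    have := lswHit_two_pi_eq_measureReal_of_nonpos ν hs
    rw [lswHit, if_pos hs] at this
    exact this.symm
  have hw0 : ∀ s, 0 ≤ w s := fun s ↦ measureReal_nonneg
  have hq := lswQ_coe_six
  have hid := eq_lswHit_two_pi_of_flat (κ := 6) (by norm_num) hwa hw1 hw0 h0 (fun L hL t ht ε hε ↦ by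
    have := hfl L hL t ht ε hε
    rw [hq]
    exact this) ht
  rw [show ((6 : ℝ≥0) : ℝ) = 6 by norm_num] at hid
  exact hid.symm

/-- **`LawlerSchrammWerner2002_hittingPDE` from the renewal flatness of the arc-hitting trace at the
weak limit.** The named fact holds as soon as, for the weak limit `ν` of the laws `lswLaw R` of
`Q_{1/R}`, `w_ν(0+) = 1` and the renewal extensions of the window averages of `w_ν` are
`o((2π - θ)^{1/3})`-flat at `2π` (`L ∈ (0, 1)`, `t > 0`): `lswHit_two_pi_eq_measureReal_of_renewalFlat`
and `LawlerSchrammWerner2002_hittingPDE_of_trace`. [cite: LawlerSchrammWernerEJP2002, §2: Thm. 2.1, (2.2), (2.10), Lemma 2.2, Lemma 2.3] -/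
theorem LawlerSchrammWerner2002_hittingPDE_of_renewalFlat
    (h : ∀ ν : ProbabilityMeasure (TopologicalSpace.NonemptyCompacts ℂ), Tendsto lswLaw atTop (𝓝 ν) →
      Tendsto (fun s : ℝ ↦ (ν : Measure (TopologicalSpace.NonemptyCompacts ℂ)).real
        {K | Literature.Analysis.Complex.conformalRadius (K : Set ℂ) ≤ Real.exp (-s)}) (𝓝[>] 0) (𝓝 1) ∧
      ∀ L ∈ Ioo (0 : ℝ) 1, ∀ t : ℝ, 0 < t → ∀ ε : ℝ, 0 < ε → ∀ᶠ θ in 𝓝[<] (2 * Real.pi),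
        |renewalST 6 (fun s ↦ ∫ r in (0 : ℝ)..L, bottomDatum (s + r))
            (fun s ↦ ∫ r in (0 : ℝ)..L, (ν : Measure (TopologicalSpace.NonemptyCompacts ℂ)).real
              {K | Literature.Analysis.Complex.conformalRadius (K : Set ℂ) ≤ Real.exp (-(s + r))}) θ t -
          ∫ r in (0 : ℝ)..L, (ν : Measure (TopologicalSpace.NonemptyCompacts ℂ)).real
              {K | Literature.Analysis.Complex.conformalRadius (K : Set ℂ) ≤ Real.exp (-(t + r))}|
          ≤ ε * (2 * Real.pi - θ) ^ (1 / 3 : ℝ)) :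
    LawlerSchrammWerner2002_hittingPDE :=
  LawlerSchrammWerner2002_hittingPDE_of_trace fun ν hν _ ht ↦
    lswHit_two_pi_eq_measureReal_of_renewalFlat ν (h ν hν).1 (h ν hν).2 ht

/-- **The named fact, LSW Thm. 1.2 and Thm. 1.1 from renewal flatness at the subsequential weak
limits** (no existence of the full scaling limit needed for the last two): if every weak limit `ν`
of `lswLaw (R_k)`, `R_k → ∞`, satisfies the hypotheses of `lswHit_two_pi_eq_measureReal_of_renewalFlat`,
then `LawlerSchrammWerner2002_hittingPDE`, `LawlerSchrammWerner2002_scalingLimitExponent` and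
`oneArm_exponent` hold (`…_of_subseqTrace`, `OneArmFromTrace`). [cite: LawlerSchrammWernerEJP2002, Thm. 1.1, Thm. 1.2, §2–§3] -/
theorem oneArm_exponent_of_subseqRenewalFlat
    (h : ∀ (R : ℕ → ℝ) (ν : ProbabilityMeasure (TopologicalSpace.NonemptyCompacts ℂ)),
      Tendsto R atTop atTop → Tendsto (lswLaw ∘ R) atTop (𝓝 ν) →
      Tendsto (fun s : ℝ ↦ (ν : Measure (TopologicalSpace.NonemptyCompacts ℂ)).real
        {K | Literature.Analysis.Complex.conformalRadius (K : Set ℂ) ≤ Real.exp (-s)}) (𝓝[>] 0) (𝓝 1) ∧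
      ∀ L ∈ Ioo (0 : ℝ) 1, ∀ t : ℝ, 0 < t → ∀ ε : ℝ, 0 < ε → ∀ᶠ θ in 𝓝[<] (2 * Real.pi),
        |renewalST 6 (fun s ↦ ∫ r in (0 : ℝ)..L, bottomDatum (s + r))
            (fun s ↦ ∫ r in (0 : ℝ)..L, (ν : Measure (TopologicalSpace.NonemptyCompacts ℂ)).real
              {K | Literature.Analysis.Complex.conformalRadius (K : Set ℂ) ≤ Real.exp (-(s + r))}) θ t -
          ∫ r in (0 : ℝ)..L, (ν : Measure (TopologicalSpace.NonemptyCompacts ℂ)).real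
              {K | Literature.Analysis.Complex.conformalRadius (K : Set ℂ) ≤ Real.exp (-(t + r))}|
          ≤ ε * (2 * Real.pi - θ) ^ (1 / 3 : ℝ)) :
    LawlerSchrammWerner2002_hittingPDE ∧ LawlerSchrammWerner2002_scalingLimitExponent ∧ oneArm_exponent := by
  have htr : ∀ (R : ℕ → ℝ) (ν : ProbabilityMeasure (TopologicalSpace.NonemptyCompacts ℂ)),
      Tendsto R atTop atTop → Tendsto (lswLaw ∘ R) atTop (𝓝 ν) →
        ∀ t : ℝ, 0 < t → lswHit 6 (2 * Real.pi) t = (ν : Measure (TopologicalSpace.NonemptyCompacts ℂ)).real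
          {K | Literature.Analysis.Complex.conformalRadius (K : Set ℂ) ≤ Real.exp (-t)} :=
    fun R ν hR hν _ ht ↦ lswHit_two_pi_eq_measureReal_of_renewalFlat ν (h R ν hR hν).1 (h R ν hR hν).2 ht
  exact ⟨LawlerSchrammWerner2002_hittingPDE_of_subseqTrace htr,
    LawlerSchrammWerner2002_scalingLimitExponent_of_subseqTrace htr, oneArm_exponent_of_subseqTrace htr⟩

/-- **The trace identification at one probability measure, LSW's hypothesis set.** For a probability
measure `ν` on non-empty compacts with `w_ν(t) = ν{K | 𝔯(K) ≤ e^{-t}}`: if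
`renewalST 6 1_{≤0} w_ν θ s ≤ w_ν(s)` on `(0, 2π) × ℝ` (LSW: (2.10) for the arc hitting function
`h(θ, ·) = renewalST 6 1_{≤0} w_ν θ ·`, and `h(θ, ·) ≤ h(2π, ·) = w_ν`) and, for every `L ∈ (0, 1)`,
`t > 0`, `ε > 0`, eventually as `θ ↑ 2π`,
`renewalST 6 (win_L 1_{≤0}) (win_L w_ν) θ t - win_L w_ν(t) ≥ -ε (2π - θ)^{1/3}` (Lemma 2.3 for the
window averages `h̃`, weakened from `o(2π - θ)` to `o((2π - θ)^{1/3})`), then `u(2π, ·) = w_ν` on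
`(0, ∞)`. [cite: LawlerSchrammWernerEJP2002, §2: Thm. 2.1, (2.2), (2.10), Lemma 2.3 (2.12)] -/
theorem lswHit_two_pi_eq_measureReal_of_renewal (ν : ProbabilityMeasure (TopologicalSpace.NonemptyCompacts ℂ))
    (hdom : ∀ θ ∈ Ioo 0 (2 * Real.pi), ∀ s : ℝ,
      renewalST 6 bottomDatum (fun s ↦ (ν : Measure (TopologicalSpace.NonemptyCompacts ℂ)).real
        {K | Literature.Analysis.Complex.conformalRadius (K : Set ℂ) ≤ Real.exp (-s)}) θ s ≤
        (ν : Measure (TopologicalSpace.NonemptyCompacts ℂ)).real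
          {K | Literature.Analysis.Complex.conformalRadius (K : Set ℂ) ≤ Real.exp (-s)})
    (hfl : ∀ L ∈ Ioo (0 : ℝ) 1, ∀ t : ℝ, 0 < t → ∀ ε : ℝ, 0 < ε → ∀ᶠ θ in 𝓝[<] (2 * Real.pi),
        -(ε * (2 * Real.pi - θ) ^ (1 / 3 : ℝ)) ≤
          renewalST 6 (fun s ↦ ∫ r in (0 : ℝ)..L, bottomDatum (s + r))
            (fun s ↦ ∫ r in (0 : ℝ)..L, (ν : Measure (TopologicalSpace.NonemptyCompacts ℂ)).real
              {K | Literature.Analysis.Complex.conformalRadius (K : Set ℂ) ≤ Real.exp (-(s + r))}) θ t -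
          ∫ r in (0 : ℝ)..L, (ν : Measure (TopologicalSpace.NonemptyCompacts ℂ)).real
              {K | Literature.Analysis.Complex.conformalRadius (K : Set ℂ) ≤ Real.exp (-(t + r))})
    {t : ℝ} (ht : 0 < t) :
    lswHit 6 (2 * Real.pi) t = (ν : Measure (TopologicalSpace.NonemptyCompacts ℂ)).real
      {K | Literature.Analysis.Complex.conformalRadius (K : Set ℂ) ≤ Real.exp (-t)} := by
  set w : ℝ → ℝ := fun s ↦ (ν : Measure (TopologicalSpace.NonemptyCompacts ℂ)).real
    {K | Literature.Analysis.Complex.conformalRadius (K : Set ℂ) ≤ Real.exp (-s)} with hw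
  have hwa : Antitone w := fun a b hab ↦ by
    simp only [hw]
    exact measureReal_mono (fun K (hK : _ ≤ _) ↦ hK.trans (Real.exp_le_exp.2 (neg_le_neg hab)))
  have hw1 : ∀ s, s ≤ 0 → w s = 1 := fun s hs ↦ by
    have := lswHit_two_pi_eq_measureReal_of_nonpos ν hs
    rw [lswHit, if_pos hs] at this
    exact this.symm
  have hw0 : ∀ s, 0 ≤ w s := fun s ↦ measureReal_nonneg
  have hq := lswQ_coe_six
  have hid := eq_lswHit_two_pi_of_renewal (κ := 6) (by norm_num) hwa hw1 hw0 hdom (fun L hL t ht ε hε ↦ by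
    have := hfl L hL t ht ε hε
    rw [hq]
    exact this) ht
  rw [show ((6 : ℝ≥0) : ℝ) = 6 by norm_num] at hid
  exact hid.symm

/-- **`LawlerSchrammWerner2002_hittingPDE`, LSW Thm. 1.2 and Thm. 1.1 from LSW's hypothesis set at
the subsequential weak limits**: if every weak limit `ν` of `lswLaw (R_k)`, `R_k → ∞`, satisfies the
hypotheses of `lswHit_two_pi_eq_measureReal_of_renewal` — (2.10) with domination for the renewal
extension of `w_ν`, and the from-below Neumann estimate of Lemma 2.3 for its window averages to order
`o((2π - θ)^{1/3})` — then the named fact, `LawlerSchrammWerner2002_scalingLimitExponent` and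
`oneArm_exponent` hold. What is left for their discharge is therefore purely probabilistic: LSW's
Thm. 2.1 (the `SLE₆` description of `Q(θ)`) giving (2.10), and the estimates (2.14)–(2.15) of the
proof of Lemma 2.3 ((2.13) and (2.16) are theorems of the tree). [cite: LawlerSchrammWernerEJP2002, Thm. 1.1, Thm. 1.2, §2] -/
theorem oneArm_exponent_of_subseqRenewal
    (h : ∀ (R : ℕ → ℝ) (ν : ProbabilityMeasure (TopologicalSpace.NonemptyCompacts ℂ)),
      Tendsto R atTop atTop → Tendsto (lswLaw ∘ R) atTop (𝓝 ν) →
      (∀ θ ∈ Ioo 0 (2 * Real.pi), ∀ s : ℝ,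
        renewalST 6 bottomDatum (fun s ↦ (ν : Measure (TopologicalSpace.NonemptyCompacts ℂ)).real
          {K | Literature.Analysis.Complex.conformalRadius (K : Set ℂ) ≤ Real.exp (-s)}) θ s ≤
          (ν : Measure (TopologicalSpace.NonemptyCompacts ℂ)).real
            {K | Literature.Analysis.Complex.conformalRadius (K : Set ℂ) ≤ Real.exp (-s)}) ∧
      ∀ L ∈ Ioo (0 : ℝ) 1, ∀ t : ℝ, 0 < t → ∀ ε : ℝ, 0 < ε → ∀ᶠ θ in 𝓝[<] (2 * Real.pi),
        -(ε * (2 * Real.pi - θ) ^ (1 / 3 : ℝ)) ≤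
          renewalST 6 (fun s ↦ ∫ r in (0 : ℝ)..L, bottomDatum (s + r))
            (fun s ↦ ∫ r in (0 : ℝ)..L, (ν : Measure (TopologicalSpace.NonemptyCompacts ℂ)).real
              {K | Literature.Analysis.Complex.conformalRadius (K : Set ℂ) ≤ Real.exp (-(s + r))}) θ t -
          ∫ r in (0 : ℝ)..L, (ν : Measure (TopologicalSpace.NonemptyCompacts ℂ)).real
              {K | Literature.Analysis.Complex.conformalRadius (K : Set ℂ) ≤ Real.exp (-(t + r))}) :
    LawlerSchrammWerner2002_hittingPDE ∧ LawlerSchrammWerner2002_scalingLimitExponent ∧ oneArm_exponent := by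
  have htr : ∀ (R : ℕ → ℝ) (ν : ProbabilityMeasure (TopologicalSpace.NonemptyCompacts ℂ)),
      Tendsto R atTop atTop → Tendsto (lswLaw ∘ R) atTop (𝓝 ν) →
        ∀ t : ℝ, 0 < t → lswHit 6 (2 * Real.pi) t = (ν : Measure (TopologicalSpace.NonemptyCompacts ℂ)).real
          {K | Literature.Analysis.Complex.conformalRadius (K : Set ℂ) ≤ Real.exp (-t)} :=
    fun R ν hR hν _ ht ↦ lswHit_two_pi_eq_measureReal_of_renewal ν (h R ν hR hν).1 (h R ν hR hν).2 ht
  exact ⟨LawlerSchrammWerner2002_hittingPDE_of_subseqTrace htr,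
    LawlerSchrammWerner2002_scalingLimitExponent_of_subseqTrace htr, oneArm_exponent_of_subseqTrace htr⟩

end Literature.Probability.Percolation
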